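import Literature.Geometry.Kaehler.ComplexTorusEndomorphismFieldPureMultiplicities
import Literature.Geometry.Kaehler.ComplexTorusRosatiCM
import Literature.RingTheory.CentralSimple.PositiveInvolutionQuaternionTotallyReal
import Mathlib.NumberTheory.NumberField.CMField
import HarnessLib

/-!
# A CM field of degree `dim X` in `End_ℚ(X)` with all tangent multiplicities one forces quaternion
# multiplication: Hulek–Laface 2019, Prop. 5.1, exceptional case (4) (Shimura 1963, §4), in every dimension

Layer `Literature/Geometry/Kaehler`, namespace `Literature.Geometry.Kaehler.ComplexTorus`; lane `lit-hodgefound`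
(Track 2 foundations library), SKELETON row A2-32 «Albert classification» lineage, seat p12 (gen 12, row g12-#1),
sequel of `ComplexTorusEndomorphismFieldPureMultiplicities.lean` (case (3): pure multiplicities) and of
`ComplexTorusAbelianSurfaceShimura.lean` (p18: cases (1), (3), (4) at `g = 2` by a Picard-number count).
THEOREMS ONLY (no definition, no named fact; D-0026, net debt 0). CONCRETE torus level: `X = E/Φ(ℤ^ι)` a complex
torus, `V = H₁(X, ℚ) = ℚ^ι` (lattice basis), `End_ℚ(X) = endAlgRat Φ ⊆ M_ι(ℚ)`, a number field acting through
`f : K →ₐ[ℚ] M_ι(ℚ)` with `f(K) ⊆ End_ℚ(X)`, its analytic representation `ρ_a(f y)` (`analyticRepHom`) on `T₀X = E`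
and the tangent multiplicities `n_σ = dim_ℂ T_σ`, `T_σ = {v | ρ_a(f y) v = σ(y) v ∀ y}` (as in
`ComplexTorusEndomorphismFieldEigenspaces.lean`, Moonen–Zarhin's `n_σ`, Shimura's / Hulek–Laface's `(r_ν, s_ν)`);
a polarisation is a Riemann form `η` (`IsRiemannForm Φ η`) with rational Gram matrix `G`
(`G.map (↑) = latticeGram Φ η`) and Rosati involution `A ↦ A′ = rosati G A = G⁻¹ ᵗA G`.

## The print

K. Hulek, R. Laface, *On the Picard numbers of abelian varieties*, Ann. Sc. Norm. Super. Pisa Cl. Sci. (5)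
XIX (2019), §5.1 (held text `paper:arxiv-1703.05882`, p0010 L19–L45), **Proposition 5.1** and its proof,
VERBATIM: «Let `g` be a fixed positive integer. For all positive integers `ρ` that satisfy one of the conditions
above, there exists a simple abelian variety `X` of the corresponding type such that `ρ(X) = ρ`, unless we are
in one of the five following exceptional cases: • `F` is of type III, and `m := g/2e = 1`; • `F` is of type
III, `m := g/2e = 2`, and […]; • `F` is of type IV, `Σ_{ν=1}^{e₀} r_ν s_ν = 0`; • `F` is of type IV,
`m := g/d²e₀ = 2`, `d = 1` and `r_ν = s_ν = 1` for all `ν = 1, …, e₀`; • `F` is of type IV, `m := g/d²e₀ = 1`,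
`d = 2` and `r_ν = s_ν = 1` for all `ν = 1, …, e₀`. *Proof.* It is a theorem of Shimura that given an
endomorphism structure `(F, ′, ι)` one has that a general member `(X, H, ι)` of the moduli space `𝒜(ℳ, T)`
has the property `End_ℚ(X) = ι(F)`, except in the cases above (for example see [shimura63], or
[birkenhake-lange04] for a modern approach). In fact, under the assumption that our abelian variety `X` be
simple, one can show that these cases never occur: […] • `End_ℚ(X)` contains a totally indefinite quaternion
algebra `F̃` over `K₀` with `F = K ⊂ F̃`, so that `F = K ⊂ F̃ ⊂ End_ℚ(X) = F`, contradiction; […]». The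
fourth bullet (case (4)) is the subject of this file; `K₀ = K⁺` is the maximal totally real subfield of the CM
field `K`, «`d = 1, m = 2`» reads `F = K`, `dim_K H₁(X, ℚ) = 2`, i.e. `[K : ℚ] = dim X`, and «`r_ν = s_ν = 1` for
all `ν`» reads `n_σ = 1` for every complex embedding `σ` of `K`. The original is G. Shimura, *On analytic
families of polarized abelian varieties and automorphic functions*, Ann. of Math. (2) 78 (1963) 149–192, §4
(paywalled here, acq-05438), with the «modern approach» in Ch. Birkenhake, H. Lange, *Complex Abelian
Varieties*, 2nd ed. (Grundlehren 302, 2004), §9.9 (not held, acq-10211); both are cited THROUGH Hulek–Laface,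
whose sentence is the statement formalised (`exists_totallyIndefinite_quaternionAlgebra_of_forall_finrank_eq_one`).

## Route (a declared deviation: an elementary construction, not Shimura's argument on the hermitian family)

Write `ā = c(a)` for complex conjugation on `K` and `E(x, y) = ᵗx G y` on `V = ℚ^ι`. Rosati-stability of `f(K)`
makes `(f a)′ = f(ā)` (the tree's `rosati_algHom_eq_complexConj`, Lemma 2.6.6), i.e. `E(f(a)x, y) = E(x, f(ā)y)`.
§1 (pure `ℚ`-linear algebra, `AntilinearConstruction`): `V ≅ K²` through an `E`-orthogonal `K`-basis
`e₁, e₂` (non-isotropic `K`-lines exist because `K ≠ K⁺`; `2[K:ℚ] = |ι|`), and the `K`-ANTILINEAR map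
`W(s e₁ + t e₂) = t̄ e₁ + c₀ s̄ e₂`, with `c₀ ∈ K⁺ \ {0}` solved in the `ℚ`-dual of `K` so that
**`E(f(a)x, Wx) = 0` for all `a, x`** (`W` maps every `K`-line into its `E`-orthogonal); then
`W f(a) = f(ā) W`, `W² = f(c₀)` and `ᵗW G W = G f(c₀)` (`exists_antilinear_matrix`). §0 (sub-namespace
`NumberFieldAction`, any finite-dimensional complex `T` with a `K`-action `g` and a real non-degenerate
`(1,1)`-form `e` with `e(g(a)u, v) = e(u, g(ā)v)`): the simultaneous eigenspaces `T_σ` are pairwise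
`e`-orthogonal (`apply_eq_zero_of_mem_iInf_eigenspace_of_ne`), and if every `T_σ` has dimension `≤ 1` then
an `ℝ`-linear `K`-antilinear `V` with `e(g(a)u, Vu) = 0` is `ℂ`-LINEAR (`map_I_smul_of_forall_finrank_le_one`:
for `u ∈ T_σ` the vector `Vu + i V(iu)` lies in the line `T_σ` and is `e`-orthogonal to everything). §2: applied
to `ρ_a ∘ f` on `T₀X` this puts `W` in `End_ℚ(X)` (`mem_endAlgRat_of_antilinear`); positivity of the
polarisation on a tangent eigenvector gives `φ(c₀) > 0` in every embedding (`embedding_re_pos_of_similitude`: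
`H(Wu, Wu) = φ(c₀) H(u, u)`). §3: with `θ ∈ K`, `θ̄ = -θ ≠ 0`, the map `ℍ[K⁺, θ², c₀] → M_ι(ℚ)`,
`z₁ + z₂ j ↦ f(z₁) + f(z₂)W`, is an injective `ℚ`-algebra map (`exists_quaternionAlgebra_algHom`); `ℍ[K⁺, θ², c₀]`
is a quaternion algebra over `K⁺` (the tree's `QuaternionAlgebra.isQuaternionAlgebra_holds`) split at every real
place since `c₀ ≫ 0` (the tree's `not_isSplitAtInfinite_quaternionAlgebra_iff_of_isReal`).

## What is proved (theorems only)

* §0 `NumberFieldAction.apply_eq_zero_of_mem_iInf_eigenspace_of_ne` (orthogonality of eigenspaces),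
  `NumberFieldAction.add_I_smul_mem_iInf_eigenspace`, **`NumberFieldAction.map_I_smul_of_forall_finrank_le_one`**.
* §1 `AntilinearConstruction.exists_gram_ne_zero`, `exists_orthogonal_vector`, `exists_coordEquiv` (`V ≅ K²`),
  **`AntilinearConstruction.exists_antilinear_matrix`** (the antilinear `E`-symmetric similitude `W`).
* §2 `mem_endAlgRat_of_antilinear`, `embedding_re_pos_of_similitude`,
  **`exists_antilinear_mem_endAlgRat_of_forall_finrank_eq_one`**: `W ∈ End_ℚ(X)`, `W f(a) = f(ā) W`,
  `W² = f(c₀)`, `c̄₀ = c₀ ≠ 0` totally positive, `ᵗW G W = G f(c₀)`, `E(f(a)x, Wx) = 0`.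
* §3 `exists_quaternionAlgebra_algHom`, `forall_algHom_ne_of_antilinear`,
  **`exists_totallyIndefinite_quaternionAlgebra_of_forall_finrank_eq_one`** — HULEK–LAFACE'S SENTENCE: an
  injective `Ψ : ℍ[K⁺, α, c₀] →ₐ[ℚ] M_ι(ℚ)` with image in `End_ℚ(X)`, `IsQuaternionAlgebra K⁺ ℍ[K⁺, α, c₀]`,
  `IsTotallyIndefinite K⁺ ℍ[K⁺, α, c₀]`, `f(K) ⊆ im Ψ`, `im Ψ ⊄ f(K)`.
* §4 `exists_mem_endAlgRat_forall_ne_of_forall_finrank_eq_one` (`End_ℚ(X) ⊋ f(K)`),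
  `card_le_finrank_endAlgRat_of_forall_finrank_eq_one` (`dim_ℚ End_ℚ(X) ≥ 2 dim X`),
  **`exists_finrank_ne_one_of_range_eq_endAlgRat`** (NON-OCCURRENCE: no polarised complex torus has
  `End_ℚ(X) ≅ K` CM with `[K:ℚ] = dim X` and all `n_σ = 1` — HL's «these cases never occur», case (4), every
  dimension), `IsSimple.exists_finrank_ne_one_and_exists_ne_zero_of_range_eq_endAlgRat` (junction with case (3)
  for simple `X`: the signature of `K = End_ℚ(X)`, `[K:ℚ] = dim X`, is neither all-one nor pure; at `dim X = 2`
  the two exclusions together are p18's «no imaginary quadratic `End_ℚ` for a simple abelian surface»).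

Not here: case (5) (`d = 2`, `m = 1`, reducible to case (4) through a `′`-stable CM maximal subfield of `F`),
case (2), and Shimura's moduli statement «a general member has `End_ℚ(X) = ι(F)`».

## References

* [HulekLaface2019PicardNumbersAV] K. Hulek, R. Laface, *On the Picard numbers of abelian varieties*, Ann. Sc.
  Norm. Super. Pisa Cl. Sci. (5) XIX (2019), §5.1 Prop. 5.1 and proof (exceptional case (4)); arXiv:1703.05882 p. 10.
* [Shimura1963AnalyticFamilies] G. Shimura, *On analytic families of polarized abelian varieties and automorphic
  functions*, Ann. of Math. (2) 78 (1963) 149–192, §4.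
* Ch. Birkenhake, H. Lange, *Complex Abelian Varieties*, 2nd ed., Grundlehren 302 (Springer 2004), Ch. 9 §9.9
  (Hulek–Laface's [birkenhake-lange04]; not held, acq-10211).
* [Lange2023AbelianVarietiesComplex] H. Lange, *Abelian Varieties over the Complex Numbers* (2023), §2.4.1
  (Rosati involution, Prop. 2.4.2), §2.6.2 Lemma 2.6.6 (`′` is complex conjugation on a CM centre).
* [Deligne1982HodgeCycles] P. Deligne, *Hodge cycles on abelian varieties*, LNM 900 (1982), I Prop. 5.1 (the
  Rosati involution on a CM `End` is complex conjugation; the tree's `ComplexTorusRosatiCM`).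
-/

noncomputable section

open Module Matrix Complex NumberField
open scoped ComplexConjugate Quaternion

namespace Literature.Geometry.Kaehler

namespace ComplexTorus

/-! ## §0 The abstract mechanism: a `K`-antilinear `e`-symmetric map on a space whose `K`-eigenspaces are
`e`-orthogonal complex lines is `ℂ`-linear -/

namespace NumberFieldAction

section Semilinear

variable {K : Type*} [Field K] [NumberField K] {W : Type*} [AddCommGroup W] [Module ℂ W]
  (g : K →+* Module.End ℂ W) (e : W →ₗ[ℝ] W →ₗ[ℝ] ℝ)

/-- For a real bilinear form of type `(1,1)` (`e(iu, iv) = e(u, v)`): `e(iu, v) = -e(u, iv)`. [folklore] -/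
private theorem apply_I_smul_left (he : ∀ u v, e (I • u) (I • v) = e u v) (u v : W) :
    e (I • u) v = -e u (I • v) := by
  have h := he u (-(I • v))
  rw [smul_neg, ← mul_smul, I_mul_I, neg_smul, one_smul, neg_neg] at h
  rw [h, map_neg]

/-- For a real bilinear form of type `(1,1)`: `e(z • u, v) = e(u, z̄ • v)` for every complex scalar `z`
(`e` is the imaginary part of a hermitian form). [folklore] -/
private theorem apply_smul_left (he : ∀ u v, e (I • u) (I • v) = e u v) (z : ℂ) (u v : W) :
    e (z • u) v = e u (conj z • v) := by
  have h1 : z • u = z.re • u + z.im • (I • u) := by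
    conv_lhs => rw [← re_add_im z]
    rw [add_smul, mul_smul, Complex.coe_smul, Complex.coe_smul]
  have h2 : conj z • v = z.re • v + (-z.im) • (I • v) := by
    conv_lhs => rw [← re_add_im z]
    rw [map_add, map_mul, conj_ofReal, conj_ofReal, conj_I, mul_neg, ← neg_mul, ← ofReal_neg, add_smul,
      mul_smul, Complex.coe_smul, Complex.coe_smul]
  rw [h1, h2, map_add, LinearMap.add_apply, map_smul, LinearMap.smul_apply, map_smul, LinearMap.smul_apply,
    apply_I_smul_left e he, map_add, (e u).map_smul, (e u).map_smul]
  simp only [smul_eq_mul, neg_mul, mul_neg]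

/-- If `e(u, d • w) = 0` for all `w` in a complex subspace `S` and some `d ≠ 0`, then `e(u, w) = 0` on `S`.
[folklore] -/
private theorem apply_eq_zero_of_apply_smul_eq_zero {u : W} {S : Submodule ℂ W} {d : ℂ} (hd : d ≠ 0)
    (h : ∀ w ∈ S, e u (d • w) = 0) (w : W) (hw : w ∈ S) : e u w = 0 := by
  have h' := h (d⁻¹ • w) (S.smul_mem _ hw)
  rwa [← mul_smul, mul_inv_cancel₀ hd, one_smul] at h'

variable (c : K → K) (hc : ∀ (φ : K →+* ℂ) (a : K), φ (c a) = conj (φ a))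

include hc in
omit [NumberField K] in
/-- **The simultaneous eigenspaces `W_σ`, `W_τ` (`σ ≠ τ`) are `e`-orthogonal** for a real `(1,1)`-form `e`
making the `K`-action `c`-adjoint (`e(g(a)u, v) = e(u, g(ā)v)`, `σ(ā) = \overline{σ a}`): from
`e(g(y)u, v) = e(u, g(ȳ)v)` one gets `e(u, (\overline{σ y} - \overline{τ y}) • v) = 0`, and `σ y ≠ τ y` for
some `y`. [cite: HulekLaface2019PicardNumbersAV, §5.1 Prop. 5.1 (proof, case (4))] -/
theorem apply_eq_zero_of_mem_iInf_eigenspace_of_ne (he : ∀ u v, e (I • u) (I • v) = e u v)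
    (hadj : ∀ a u v, e (g a u) v = e u (g (c a) v)) {σ τ : K →+* ℂ} (hστ : σ ≠ τ) {u v : W}
    (hu : u ∈ ⨅ y : K, (g y).eigenspace (σ y)) (hv : v ∈ ⨅ y : K, (g y).eigenspace (τ y)) :
    e u v = 0 := by
  obtain ⟨y, hy⟩ : ∃ y, σ y ≠ τ y := by
    by_contra h
    simp only [ne_eq, not_exists, not_not] at h
    exact hστ (RingHom.ext h)
  have hd : conj (σ y) - conj (τ y) ≠ 0 := by
    rw [sub_ne_zero]
    exact fun h => hy (star_injective h)
  refine apply_eq_zero_of_apply_smul_eq_zero e hd (fun w hw => ?_) v hv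
  rw [Submodule.mem_iInf] at hu hw
  have h1 : e (g y u) w = e u (g (c y) w) := hadj y u w
  rw [Module.End.mem_eigenspace_iff.mp (hu y), Module.End.mem_eigenspace_iff.mp (hw (c y)), hc,
    apply_smul_left e he] at h1
  rw [sub_smul, map_sub, h1, sub_self]

/-- A real-linear functional on `ℂ` vanishing at `1` and at one non-real point vanishes identically.
[folklore] -/
private theorem eq_zero_of_apply_one_of_apply_nonreal (ψ : ℂ →ₗ[ℝ] ℝ) (h1 : ψ 1 = 0) {z₀ : ℂ} (hz₀ : z₀.im ≠ 0)
    (h0 : ψ z₀ = 0) (z : ℂ) : ψ z = 0 := by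
  have hI : ψ I = 0 := by
    have h := h0
    rw [← re_add_im z₀, map_add, ← smul_eq_mul, Complex.coe_smul, map_smul, ← mul_one (z₀.re : ℂ),
      ← smul_eq_mul, Complex.coe_smul, map_smul, h1, smul_zero, zero_add, smul_eq_mul] at h
    exact (mul_eq_zero.mp h).resolve_left hz₀
  rw [← re_add_im z, map_add, ← smul_eq_mul, Complex.coe_smul, map_smul, hI, smul_zero, add_zero,
    ← mul_one (z.re : ℂ), ← smul_eq_mul, Complex.coe_smul, map_smul, h1, smul_zero]

variable (V : W →ₗ[ℝ] W)

omit [NumberField K] in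
/-- On an eigen-LINE through `u ∈ W_σ` (`σ` non-real), a `K`-orthogonality relation
`e(g(a)u, Vu) = 0 ∀ a` spreads to all complex multiples: `e(z • u, Vu) = 0`. [cite: HulekLaface2019PicardNumbersAV, §5.1 Prop. 5.1 (proof, case (4))] -/
theorem apply_smul_eq_zero_of_forall_apply_eq_zero {σ : K →+* ℂ} (hσ : ¬ ComplexEmbedding.IsReal σ)
    {u : W} (hu : u ∈ ⨅ y : K, (g y).eigenspace (σ y)) (horth : ∀ a, e (g a u) (V u) = 0) (z : ℂ) :
    e (z • u) (V u) = 0 := by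
  obtain ⟨a₀, ha₀⟩ : ∃ a₀, (σ a₀).im ≠ 0 := by
    by_contra h
    simp only [ne_eq, not_exists, not_not] at h
    apply hσ
    rw [ComplexEmbedding.isReal_iff]
    refine RingHom.ext fun x => ?_
    rw [ComplexEmbedding.conjugate_coe_eq]
    exact Complex.ext (by rw [conj_re]) (by rw [conj_im, h, neg_zero])
  rw [Submodule.mem_iInf] at hu
  let ψ : ℂ →ₗ[ℝ] ℝ := (e.flip (V u)).restrictScalars ℝ ∘ₗ ((LinearMap.lsmul ℂ W).flip u).restrictScalars ℝ
  have hψ : ∀ w : ℂ, ψ w = e (w • u) (V u) := fun w => rfl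
  have hψσ : ∀ a, ψ (σ a) = 0 := fun a => by
    rw [hψ, ← Module.End.mem_eigenspace_iff.mp (hu a)]
    exact horth a
  rw [← hψ]
  refine eq_zero_of_apply_one_of_apply_nonreal ψ ?_ ha₀ (hψσ a₀) z
  rw [← map_one σ]
  exact hψσ 1

/-- In a complex vector space of dimension `≤ 1` over a non-zero vector, everything is a multiple. [folklore] -/
private theorem exists_smul_eq_of_finrank_le_one {S : Submodule ℂ W} [FiniteDimensional ℂ S]
    (hS : finrank ℂ S ≤ 1) {u : W} (hu : u ∈ S) (hu0 : u ≠ 0) {x : W} (hx : x ∈ S) :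
    ∃ z : ℂ, x = z • u := by
  obtain ⟨v, hv⟩ := finrank_le_one_iff.mp hS
  obtain ⟨c₀, hc₀⟩ := hv ⟨u, hu⟩
  obtain ⟨c₁, hc₁⟩ := hv ⟨x, hx⟩
  have hc₀0 : c₀ ≠ 0 := by
    rintro rfl
    rw [zero_smul] at hc₀
    exact hu0 (congrArg Subtype.val hc₀).symm
  refine ⟨c₁ * c₀⁻¹, ?_⟩
  have h := congrArg Subtype.val hc₁
  have h0 := congrArg Subtype.val hc₀
  simp only [SetLike.val_smul] at h h0
  rw [← h, ← h0, ← mul_smul, inv_mul_cancel_right₀ hc₀0]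

variable (hcc : ∀ a, c (c a) = a)

include hc hcc in
omit [NumberField K] in
/-- **The key identity.** For an `ℝ`-linear `K`-ANTILINEAR `V` (`V g(a) = g(ā) V`) and `u ∈ W_σ`:
`Vu + i·V(iu) ∈ W_σ` (and symmetrically `Vu - i·V(iu) ∈ W_σ̄`): `g(y)` acts on `Vu`, `V(iu)` through the
real and imaginary parts of `\overline{σ y}`. [cite: HulekLaface2019PicardNumbersAV, §5.1 Prop. 5.1 (proof, case (4))] -/
theorem add_I_smul_mem_iInf_eigenspace (hV : ∀ a w, V (g a w) = g (c a) (V w)) {σ : K →+* ℂ} {u : W}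
    (hu : u ∈ ⨅ y : K, (g y).eigenspace (σ y)) :
    V u + I • V (I • u) ∈ ⨅ y : K, (g y).eigenspace (σ y) := by
  rw [Submodule.mem_iInf] at hu ⊢
  intro y
  have hgV : ∀ w, g y (V w) = V (g (c y) w) := fun w => by rw [hV, hcc]
  -- `z • w = Re z • w + Im z • (iw)` and its image under the `ℝ`-linear `V`
  have hz : ∀ (z : ℂ) (w : W), z • w = z.re • w + z.im • (I • w) := fun z w => by
    conv_lhs => rw [← re_add_im z]
    rw [add_smul, mul_smul, Complex.coe_smul, Complex.coe_smul]
  have hdec : ∀ (z : ℂ) (w : W), V (z • w) = z.re • V w + z.im • V (I • w) := fun z w => by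
    rw [hz z w, map_add, V.map_smul, V.map_smul]
  have huy : g (c y) u = conj (σ y) • u := by
    rw [Module.End.mem_eigenspace_iff.mp (hu (c y)), hc]
  have huyI : g (c y) (I • u) = conj (σ y) • I • u := by
    rw [LinearMap.map_smul, huy, smul_comm]
  have hIIu : I • I • u = -u := by rw [← mul_smul, I_mul_I, neg_smul, one_smul]
  rw [Module.End.mem_eigenspace_iff, map_add, LinearMap.map_smul, hgV, hgV, huy, huyI,
    hdec (conj (σ y)) u, hdec (conj (σ y)) (I • u), hIIu, map_neg, conj_re, conj_im,
    hz (σ y) (V u + I • V (I • u))]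
  -- both sides are real combinations of `Vu`, `V(iu)`, `iVu`, `iV(iu)`
  simp only [smul_add, smul_neg, neg_smul, smul_comm I (_ : ℝ) (_ : W), ← mul_smul I I, I_mul_I, one_smul]
  abel

variable [FiniteDimensional ℂ W]

include hc hcc in
/-- **Abstract form of the case-(4) mechanism.** Let a number field `K` act on a finite-dimensional complex
vector space `W` (`g : K → End_ℂ W`), `K` totally complex with an involution `c` inducing complex
conjugation in every complex embedding, and let `e` be a real bilinear form of type `(1,1)`, non-degenerate,
for which the action is `c`-adjoint. If every simultaneous eigenspace `W_σ` has dimension `≤ 1`, then every `ℝ`-linear, `K`-antilinear `V : W → W` with `e(g(a)u, Vu) = 0` for all `a, u` is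
`ℂ`-LINEAR. (For `u ∈ W_σ` the vector `A = Vu + iV(iu)` lies in the line `W_σ`, is `e`-orthogonal to
`W_σ` by the hypothesis spread over the line, and to every other `W_τ` by orthogonality of eigenspaces;
non-degeneracy gives `A = 0`, i.e. `V(iu) = iVu`.) [cite: HulekLaface2019PicardNumbersAV, §5.1 Prop. 5.1 (proof, case (4))]
[cite: Shimura1963AnalyticFamilies, §4 (via Hulek–Laface)] -/
theorem map_I_smul_of_forall_finrank_le_one (he : ∀ u v, e (I • u) (I • v) = e u v)
    (hnd : ∀ v, (∀ u, e u v = 0) → v = 0) (hadj : ∀ a u v, e (g a u) v = e u (g (c a) v))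
    (hV : ∀ a w, V (g a w) = g (c a) (V w)) (horth : ∀ a u, e (g a u) (V u) = 0)
    (htc : ∀ σ : K →+* ℂ, ¬ ComplexEmbedding.IsReal σ)
    (hline : ∀ σ : K →+* ℂ, finrank ℂ ↥(⨅ y : K, (g y).eigenspace (σ y)) ≤ 1) (u : W) :
    V (I • u) = I • V u := by
  -- reduce to `u` in a simultaneous eigenspace
  suffices key : ∀ (σ : K →+* ℂ), ∀ u ∈ ⨅ y : K, (g y).eigenspace (σ y), V (I • u) = I • V u by
    have hu : u ∈ ⨆ σ : K →+* ℂ, ⨅ y : K, (g y).eigenspace (σ y) := by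
      rw [iSup_iInf_eigenspace_eq_top g]; exact Submodule.mem_top
    induction hu using Submodule.iSup_induction' with
    | mem σ x hx => exact key σ x hx
    | zero => rw [smul_zero, map_zero, smul_zero]
    | add x y _ _ hx hy => rw [smul_add, map_add, hx, hy, map_add, smul_add]
  intro σ u hu
  by_cases hu0 : u = 0
  · rw [hu0, smul_zero, map_zero, smul_zero]
  have hσ : ¬ ComplexEmbedding.IsReal σ := htc σ
  -- `A = Vu + iV(iu) ∈ W_σ` is `e`-orthogonal to everything
  obtain ⟨A, hA_def⟩ : ∃ A : W, A = V u + I • V (I • u) := ⟨_, rfl⟩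
  have hA : A ∈ ⨅ y : K, (g y).eigenspace (σ y) :=
    hA_def ▸ add_I_smul_mem_iInf_eigenspace g c hc V hcc hV hu
  have hIu : I • u ∈ ⨅ y : K, (g y).eigenspace (σ y) := Submodule.smul_mem _ I hu
  have horthA : ∀ x, e x A = 0 := by
    intro x
    have hx : x ∈ ⨆ τ : K →+* ℂ, ⨅ y : K, (g y).eigenspace (τ y) := by
      rw [iSup_iInf_eigenspace_eq_top g]; exact Submodule.mem_top
    induction hx using Submodule.iSup_induction' with
    | mem τ x hx =>
      by_cases hτσ : τ = σ
      · subst hτσ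
        obtain ⟨z, rfl⟩ := exists_smul_eq_of_finrank_le_one (hline τ) hu hu0 hx
        rw [hA_def, map_add, apply_smul_eq_zero_of_forall_apply_eq_zero g e V hσ hu (fun a => horth a u) z,
          zero_add, ← neg_neg (I • V (I • u)), ← neg_smul, ← conj_I, map_neg, ← apply_smul_left e he,
          smul_comm, neg_eq_zero]
        exact apply_smul_eq_zero_of_forall_apply_eq_zero g e V hσ hIu (fun a => horth a (I • u)) z
      · exact apply_eq_zero_of_mem_iInf_eigenspace_of_ne g e c hc he hadj hτσ hx hA
    | zero => rw [map_zero, LinearMap.zero_apply]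
    | add x y _ _ hx hy => rw [e.map_add, LinearMap.add_apply, hx, hy, add_zero]
  have hA0 : A = 0 := hnd A horthA
  -- `Vu + iV(iu) = 0` ⟹ `V(iu) = iVu`
  have h : I • A = 0 := by rw [hA0, smul_zero]
  rw [hA_def, smul_add, ← mul_smul, I_mul_I, neg_smul, one_smul, add_neg_eq_zero] at h
  exact h.symm

end Semilinear

end NumberFieldAction


/-! ## §1 The rational construction: `V = ℚ^ι ≅ K²`, an `E`-orthogonal `K`-basis, and the antilinear
`E`-symmetric similitude `W` -/

namespace AntilinearConstruction

section Dual

variable {K : Type*} [Field K] [NumberField K]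

/-- For a non-zero `ℚ`-linear functional `α` on a number field `K`, `b ↦ α(b ·)` is injective:
`α(b m) = 0` for all `m` forces `b = 0`. [folklore] -/
private theorem eq_zero_of_forall_apply_mul_eq_zero (α : K →ₗ[ℚ] ℚ) (hα : α ≠ 0) {b : K}
    (h : ∀ m, α (b * m) = 0) : b = 0 := by
  by_contra hb
  apply hα
  ext m
  have := h (b⁻¹ * m)
  rwa [← mul_assoc, mul_inv_cancel₀ hb, one_mul] at this

/-- For a non-zero `ℚ`-linear functional `α` on a number field `K`, every functional is `α(b ·)` for a
unique `b ∈ K` (`b ↦ α(b ·)` is an injective `ℚ`-linear map `K → K^∨` between spaces of the same finite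
dimension). [folklore] -/
private theorem exists_forall_apply_mul_eq (α : K →ₗ[ℚ] ℚ) (hα : α ≠ 0) (ℓ : K →ₗ[ℚ] ℚ) :
    ∃ b : K, ∀ m, α (b * m) = ℓ m := by
  let Λ : K →ₗ[ℚ] (K →ₗ[ℚ] ℚ) :=
    { toFun := fun b => α ∘ₗ LinearMap.mulLeft ℚ b
      map_add' := fun b b' => by ext m; simp [add_mul]
      map_smul' := fun q b => by ext m; simp }
  have hΛ : ∀ b m, Λ b m = α (b * m) := fun b m => rfl
  have hinj : Function.Injective Λ := by
    rw [← LinearMap.ker_eq_bot, LinearMap.ker_eq_bot']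
    intro b hb
    exact eq_zero_of_forall_apply_mul_eq_zero α hα fun m => by rw [← hΛ, hb, LinearMap.zero_apply]
  have hdim : finrank ℚ K = finrank ℚ (K →ₗ[ℚ] ℚ) := (Subspace.dual_finrank_eq).symm
  obtain ⟨b, hb⟩ := (LinearMap.injective_iff_surjective_of_finrank_eq_finrank hdim).mp hinj ℓ
  exact ⟨b, fun m => by rw [← hΛ, hb]⟩

end Dual

section Matrices

variable {ι : Type*} [Fintype ι] [DecidableEq ι]

/-- Two matrices with the same bilinear form `ᵗx M y` are equal. [folklore] -/
private theorem eq_of_forall_dotProduct_mulVec_eq {R : Type*} [CommRing R] {M N : Matrix ι ι R}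
    (h : ∀ x y, x ⬝ᵥ M *ᵥ y = x ⬝ᵥ N *ᵥ y) : M = N :=
  Matrix.toBilin'.injective (LinearMap.ext₂ fun x y => by
    rw [Matrix.toBilin'_apply', Matrix.toBilin'_apply', h])

/-- Two matrices with the same action on vectors are equal. [folklore] -/
private theorem eq_of_forall_mulVec_eq {R : Type*} [CommRing R] {M N : Matrix ι ι R}
    (h : ∀ x, M *ᵥ x = N *ᵥ x) : M = N :=
  Matrix.toLin'.injective (LinearMap.ext fun x => by rw [Matrix.toLin'_apply, Matrix.toLin'_apply, h])

omit [DecidableEq ι] in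
/-- For an antisymmetric `G`: `ᵗy G x = -ᵗx G y`. [folklore] -/
private theorem dotProduct_mulVec_of_transpose_eq_neg {R : Type*} [CommRing R] {G : Matrix ι ι R} (hG : Gᵀ = -G)
    (x y : ι → R) : y ⬝ᵥ G *ᵥ x = -(x ⬝ᵥ G *ᵥ y) := by
  rw [Matrix.dotProduct_mulVec x G, ← Matrix.mulVec_transpose, hG, Matrix.neg_mulVec, neg_dotProduct,
    neg_neg, dotProduct_comm]

/-- Over an invertible Gram matrix a vector `E`-orthogonal to everything vanishes. [folklore] -/
private theorem eq_zero_of_forall_dotProduct_mulVec_eq_zero {R : Type*} [CommRing R] {G : Matrix ι ι R}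
    (hGu : IsUnit G.det) {v : ι → R} (h : ∀ x, x ⬝ᵥ G *ᵥ v = 0) : v = 0 := by
  have hGv : G *ᵥ v = 0 := by
    funext i
    have := h (Pi.single i 1)
    rwa [single_dotProduct, one_mul] at this
  calc v = (G⁻¹ * G) *ᵥ v := by rw [Matrix.nonsing_inv_mul _ hGu, Matrix.one_mulVec]
    _ = 0 := by rw [← Matrix.mulVec_mulVec, hGv, Matrix.mulVec_zero]

/-- … and symmetrically on the left. [folklore] -/
private theorem eq_zero_of_forall_dotProduct_mulVec_eq_zero_left {R : Type*} [CommRing R] {G : Matrix ι ι R}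
    (hGu : IsUnit G.det) {v : ι → R} (h : ∀ y, v ⬝ᵥ G *ᵥ y = 0) : v = 0 := by
  have h' : ∀ z, v ⬝ᵥ z = 0 := fun z => by
    have := h (G⁻¹ *ᵥ z)
    rwa [Matrix.mulVec_mulVec, Matrix.mul_nonsing_inv _ hGu, Matrix.one_mulVec] at this
  funext i
  have := h' (Pi.single i 1)
  rwa [dotProduct_single, mul_one] at this

end Matrices

section Construction

variable {ι : Type*} [Fintype ι] [DecidableEq ι] {K : Type*} [Field K] [NumberField K]
  (f : K →ₐ[ℚ] Matrix ι ι ℚ) (c : K →ₐ[ℚ] K) {G : Matrix ι ι ℚ}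

/-- The orbit map `t ↦ f(t) e` of a vector `e ∈ ℚ^ι` under the field `f(K)`, a `ℚ`-linear map `K → ℚ^ι`
(its range is the `K`-line `K e`). [folklore] -/
private theorem exists_orbit_linearMap (e : ι → ℚ) :
    ∃ orb : K →ₗ[ℚ] (ι → ℚ), ∀ t, orb t = f t *ᵥ e :=
  ⟨{ toFun := fun t => f t *ᵥ e
     map_add' := fun s t => by rw [map_add, Matrix.add_mulVec]
     map_smul' := fun q t => by rw [map_smul, Matrix.smul_mulVec, RingHom.id_apply] }, fun _ => rfl⟩

/-- The "diagonal Gram functional" `t ↦ ᵗ(f(t)e) G e = E(t·e, e)` of a vector `e`, `ℚ`-linear in `t ∈ K`.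
[folklore] -/
private theorem exists_gramFunctional (G : Matrix ι ι ℚ) (e : ι → ℚ) :
    ∃ α : K →ₗ[ℚ] ℚ, ∀ t, α t = (f t *ᵥ e) ⬝ᵥ G *ᵥ e := by
  obtain ⟨orb, horb⟩ := exists_orbit_linearMap f e
  exact ⟨(Matrix.toBilin' G).flip e ∘ₗ orb, fun t => by
    rw [LinearMap.comp_apply]
    change Matrix.toBilin' G (orb t) e = _
    rw [Matrix.toBilin'_apply', horb]⟩

variable [Nonempty ι]

/-- `f : K → M_ι(ℚ)` is injective (a ring map out of a field into a non-trivial ring). [folklore] -/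
private theorem algHom_injective : Function.Injective f := (f : K →+* Matrix ι ι ℚ).injective

/-- **A non-isotropic `K`-line exists.** If the involution `c` is non-trivial (`K ≠ K₀`) and `G` is an
invertible alternating Gram matrix with `(f a)′ = f(ā)` (Rosati = `c` on `f(K)`), some vector `e₁` has
`E(a₁e₁, e₁) ≠ 0`: otherwise polarisation gives `E(f(a - ā)x, y) = 0` for all `x, y`, so `a = ā` for all `a`.
[cite: HulekLaface2019PicardNumbersAV, §5.1 Prop. 5.1 (proof, case (4))] -/
theorem exists_gram_ne_zero (hG : Gᵀ = -G) (hGu : IsUnit G.det) (hros : ∀ a, rosati G (f a) = f (c a))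
    (hcc : ∀ a, c (c a) = a) (hc1 : ∃ a, c a ≠ a) :
    ∃ (e₁ : ι → ℚ) (a₁ : K), (f a₁ *ᵥ e₁) ⬝ᵥ G *ᵥ e₁ ≠ 0 := by
  by_contra hall
  simp only [ne_eq, not_exists, not_not] at hall
  obtain ⟨a, ha⟩ := hc1
  apply ha
  have key : ∀ x, f (a - c a) *ᵥ x = 0 := by
    intro x
    refine eq_zero_of_forall_dotProduct_mulVec_eq_zero_left hGu fun y => ?_
    have h := hall (x + y) a
    rw [Matrix.mulVec_add, Matrix.mulVec_add, add_dotProduct, dotProduct_add, dotProduct_add, hall, hall,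
      zero_add, add_zero, dotProduct_mulVec_of_transpose_eq_neg hG x (f a *ᵥ y)] at h
    have h2 : x ⬝ᵥ G *ᵥ (f a *ᵥ y) = (f (c a) *ᵥ x) ⬝ᵥ G *ᵥ y := by
      rw [dotProduct_mulVec_rosati hGu, hros, hcc]
    rwa [h2, ← sub_eq_add_neg, ← sub_dotProduct, ← Matrix.sub_mulVec, ← map_sub] at h
  have hzero : f (a - c a) = 0 := eq_of_forall_mulVec_eq fun x => by rw [key, Matrix.zero_mulVec]
  have h := algHom_injective f (hzero.trans (map_zero f).symm)
  rw [sub_eq_zero] at h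
  exact h.symm

omit [Nonempty ι] in
/-- **An `E`-orthogonal second basis vector.** For `e₁` with `E(a₁e₁, e₁) ≠ 0` there is `e₂ ∉ K e₁` with
`E(a e₁, e₂) = 0` for all `a ∈ K` (take any `y ∉ K e₁` — the `K`-line has `ℚ`-dimension `[K:ℚ] < 2[K:ℚ] = |ι|`
— and subtract its `K e₁`-component, solved for in the `ℚ`-dual of `K`). [cite: HulekLaface2019PicardNumbersAV, §5.1 Prop. 5.1 (proof, case (4))] -/
theorem exists_orthogonal_vector (hGu : IsUnit G.det) (hros : ∀ a, rosati G (f a) = f (c a))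
    (hcard : Fintype.card ι = 2 * finrank ℚ K) {e₁ : ι → ℚ} {a₁ : K} (h11 : (f a₁ *ᵥ e₁) ⬝ᵥ G *ᵥ e₁ ≠ 0) :
    ∃ e₂ : ι → ℚ, (∀ a, (f a *ᵥ e₁) ⬝ᵥ G *ᵥ e₂ = 0) ∧ (∀ t, f t *ᵥ e₁ ≠ e₂) := by
  obtain ⟨α, hα⟩ := exists_gramFunctional f G e₁
  have hα0 : α ≠ 0 := fun h => h11 (by rw [← hα, h, LinearMap.zero_apply])
  obtain ⟨orb, horb⟩ := exists_orbit_linearMap f e₁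
  -- a vector outside the `K`-line `K e₁`
  obtain ⟨y, hy⟩ : ∃ y, y ∉ LinearMap.range orb := by
    by_contra h
    simp only [not_exists, not_not] at h
    have htop : LinearMap.range orb = ⊤ := Submodule.eq_top_iff'.mpr h
    have h1 : finrank ℚ ↥(LinearMap.range orb) ≤ finrank ℚ K := LinearMap.finrank_range_le orb
    rw [htop, finrank_top, Module.finrank_fintype_fun_eq_card, hcard] at h1
    have h2 : 0 < finrank ℚ K := Module.finrank_pos
    omega
  -- the functional `a ↦ E(a e₁, y)` is `α(b ·)`
  obtain ⟨ℓ, hℓ⟩ : ∃ ℓ : K →ₗ[ℚ] ℚ, ∀ a, ℓ a = (f a *ᵥ e₁) ⬝ᵥ G *ᵥ y :=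
    ⟨(Matrix.toBilin' G).flip y ∘ₗ orb, fun a => by
      rw [LinearMap.comp_apply]
      change Matrix.toBilin' G (orb a) y = _
      rw [Matrix.toBilin'_apply', horb]⟩
  obtain ⟨b, hb⟩ := exists_forall_apply_mul_eq α hα0 ℓ
  refine ⟨y - f (c b) *ᵥ e₁, fun a => ?_, fun t ht => hy ?_⟩
  · have hx : (f b *ᵥ (f a *ᵥ e₁)) ⬝ᵥ G *ᵥ e₁ = (f a *ᵥ e₁) ⬝ᵥ G *ᵥ (f (c b) *ᵥ e₁) := by
      rw [dotProduct_mulVec_rosati hGu, hros]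
    rw [Matrix.mulVec_sub, dotProduct_sub, ← hℓ, ← hb, ← hx, Matrix.mulVec_mulVec, ← map_mul, hα, sub_self]
  · refine ⟨t + c b, ?_⟩
    rw [horb, map_add, Matrix.add_mulVec, ht, sub_add_cancel]

omit [Nonempty ι] in
/-- **Coordinates**: for `e₁ ≠ 0` and `e₂ ∉ K e₁` (and `2[K:ℚ] = |ι|`) the map `(s, t) ↦ s e₁ + t e₂` is a
`ℚ`-linear isomorphism `K × K ≅ ℚ^ι` (injective since `K` is a field, onto by dimension): a `K`-basis of
`V = H₁(X, ℚ)`, «`m = 2`». [cite: HulekLaface2019PicardNumbersAV, §5.1 Prop. 5.1 (case (4): `m := g/d²e₀ = 2`)] -/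
theorem exists_coordEquiv (hcard : Fintype.card ι = 2 * finrank ℚ K) {e₁ e₂ : ι → ℚ} (he₁ : e₁ ≠ 0)
    (he₂ : ∀ t, f t *ᵥ e₁ ≠ e₂) :
    ∃ κ : (K × K) ≃ₗ[ℚ] (ι → ℚ), ∀ p, κ p = f p.1 *ᵥ e₁ + f p.2 *ᵥ e₂ := by
  obtain ⟨o₁, ho₁⟩ := exists_orbit_linearMap f e₁
  obtain ⟨o₂, ho₂⟩ := exists_orbit_linearMap f e₂
  have hκ : ∀ p : K × K, o₁.coprod o₂ p = f p.1 *ᵥ e₁ + f p.2 *ᵥ e₂ := fun p => by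
    rw [LinearMap.coprod_apply, ho₁, ho₂]
  have hinj : Function.Injective (o₁.coprod o₂) := by
    rw [← LinearMap.ker_eq_bot, LinearMap.ker_eq_bot']
    rintro ⟨s, t⟩ hst
    rw [hκ] at hst
    by_cases ht : t = 0
    · subst ht
      rw [map_zero, Matrix.zero_mulVec, add_zero] at hst
      by_cases hs : s = 0
      · subst hs; rfl
      · exfalso
        apply he₁
        calc e₁ = f (s⁻¹ * s) *ᵥ e₁ := by rw [inv_mul_cancel₀ hs, map_one, Matrix.one_mulVec]
          _ = 0 := by rw [map_mul, ← Matrix.mulVec_mulVec, hst, Matrix.mulVec_zero]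
    · exfalso
      apply he₂ (-(t⁻¹ * s))
      have h : f t *ᵥ e₂ = -(f s *ᵥ e₁) := eq_neg_of_add_eq_zero_right hst
      calc f (-(t⁻¹ * s)) *ᵥ e₁ = f t⁻¹ *ᵥ (-(f s *ᵥ e₁)) := by
            rw [map_neg, Matrix.neg_mulVec, map_mul, ← Matrix.mulVec_mulVec, Matrix.mulVec_neg]
        _ = e₂ := by rw [← h, Matrix.mulVec_mulVec, ← map_mul, inv_mul_cancel₀ ht, map_one, Matrix.one_mulVec]
  have hdim : finrank ℚ (K × K) = finrank ℚ (ι → ℚ) := by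
    rw [Module.finrank_prod, Module.finrank_fintype_fun_eq_card, hcard, two_mul]
  have hsurj := (LinearMap.injective_iff_surjective_of_finrank_eq_finrank hdim).mp hinj
  exact ⟨LinearEquiv.ofBijective _ ⟨hinj, hsurj⟩, fun p => by rw [LinearEquiv.ofBijective_apply, hκ]⟩

/-- **The `K`-antilinear `E`-symmetric endomorphism `W` of `V = H₁(X, ℚ) ≅ K²`** (rational core of
Hulek–Laface Prop. 5.1, case (4) / Shimura 1963 §4): for a number field `K` with a non-trivial involution
`c` (`ā = c a`), `f : K ↪ M_ι(ℚ)` with `2[K:ℚ] = |ι|`, and an invertible alternating `G` whose Rosati involution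
restricts to `c` on `f(K)`, there are a matrix `W` and `c₀ ∈ K` with `c̄₀ = c₀ ≠ 0` such that:
`W² = f(c₀)`, `W f(a) = f(ā) W` (antilinearity), `E(f(a)x, Wx) = 0` for all `a`, `x` (`W` maps every
`K`-line into its `E`-orthogonal) and `ᵗW G W = G f(c₀)` (`W` is a similitude of multiplier `c₀`). In an
`E`-orthogonal `K`-basis `e₁, e₂`: `W(s e₁ + t e₂) = t̄ e₁ + c₀ s̄ e₂`, with `c₀` solved from
`E(c₀ m e₂, e₂) = -E(m e₁, e₁)`. [cite: HulekLaface2019PicardNumbersAV, §5.1 Prop. 5.1 (proof, case (4): "`End_ℚ(X)` contains a totally indefinite quaternion algebra `F̃` over `K₀` with `F = K ⊂ F̃`")]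
[cite: Shimura1963AnalyticFamilies, §4 (via Hulek–Laface)] -/
theorem exists_antilinear_matrix (hG : Gᵀ = -G) (hGu : IsUnit G.det) (hros : ∀ a, rosati G (f a) = f (c a))
    (hcc : ∀ a, c (c a) = a) (hc1 : ∃ a, c a ≠ a) (hcard : Fintype.card ι = 2 * finrank ℚ K) :
    ∃ (W : Matrix ι ι ℚ) (c₀ : K), c c₀ = c₀ ∧ c₀ ≠ 0 ∧ W * W = f c₀ ∧ (∀ a, W * f a = f (c a) * W) ∧
      (∀ a x, (f a *ᵥ x) ⬝ᵥ G *ᵥ (W *ᵥ x) = 0) ∧ Wᵀ * G * W = G * f c₀ := by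
  have hadj : ∀ (a : K) (x y : ι → ℚ), (f a *ᵥ x) ⬝ᵥ G *ᵥ y = x ⬝ᵥ G *ᵥ (f (c a) *ᵥ y) :=
    fun a x y => by rw [dotProduct_mulVec_rosati hGu, hros]
  have hadj' : ∀ (a : K) (x y : ι → ℚ), x ⬝ᵥ G *ᵥ (f a *ᵥ y) = (f (c a) *ᵥ x) ⬝ᵥ G *ᵥ y :=
    fun a x y => by rw [hadj, hcc]
  -- an `E`-orthogonal `K`-basis `e₁, e₂` and the coordinates `κ`
  obtain ⟨e₁, a₁, h11⟩ := exists_gram_ne_zero f c hG hGu hros hcc hc1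
  obtain ⟨e₂, he2P, he2K⟩ := exists_orthogonal_vector f c hGu hros hcard h11
  have he₁ : e₁ ≠ 0 := fun h => h11 (by rw [h, Matrix.mulVec_zero, Matrix.mulVec_zero, zero_dotProduct])
  obtain ⟨κ, hκ⟩ := exists_coordEquiv f hcard he₁ he2K
  obtain ⟨α, hα⟩ := exists_gramFunctional f G e₁
  obtain ⟨β, hβ⟩ := exists_gramFunctional f G e₂
  have hα0 : α ≠ 0 := fun h => h11 (by rw [← hα, h, LinearMap.zero_apply])
  have hcross : ∀ s t : K, (f s *ᵥ e₁) ⬝ᵥ G *ᵥ (f t *ᵥ e₂) = 0 := fun s t => by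
    rw [hadj', Matrix.mulVec_mulVec, ← map_mul, he2P]
  have hcross' : ∀ s t : K, (f t *ᵥ e₂) ⬝ᵥ G *ᵥ (f s *ᵥ e₁) = 0 := fun s t => by
    rw [dotProduct_mulVec_of_transpose_eq_neg hG, hcross, neg_zero]
  -- the Gram form in coordinates: `E(κ(s₁,t₁), κ(s₂,t₂)) = α(s̄₂ s₁) + β(t̄₂ t₁)`
  have hgram : ∀ s₁ t₁ s₂ t₂ : K, κ (s₁, t₁) ⬝ᵥ G *ᵥ κ (s₂, t₂) = α (c s₂ * s₁) + β (c t₂ * t₁) := by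
    intro s₁ t₁ s₂ t₂
    rw [hκ, hκ, Matrix.mulVec_add, add_dotProduct, dotProduct_add, dotProduct_add, hcross, hcross',
      hadj' s₂ (f s₁ *ᵥ e₁), hadj' t₂ (f t₁ *ᵥ e₂), Matrix.mulVec_mulVec, Matrix.mulVec_mulVec, ← map_mul,
      ← map_mul, hα, hβ, add_zero, zero_add]
  have hαodd : ∀ t, α (c t) = -α t := fun t => by
    rw [hα, hα, hadj, hcc, dotProduct_mulVec_of_transpose_eq_neg hG]
  have hβodd : ∀ t, β (c t) = -β t := fun t => by
    rw [hβ, hβ, hadj, hcc, dotProduct_mulVec_of_transpose_eq_neg hG]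
  have hfκ : ∀ a s t, f a *ᵥ κ (s, t) = κ (a * s, a * t) := fun a s t => by
    rw [hκ, hκ, Matrix.mulVec_add, Matrix.mulVec_mulVec, Matrix.mulVec_mulVec, ← map_mul, ← map_mul]
  -- `β ≠ 0`: otherwise `e₂` is in the radical of `E`
  have hβ0 : β ≠ 0 := by
    intro hβz
    apply he2K 0
    rw [map_zero, Matrix.zero_mulVec]
    symm
    refine eq_zero_of_forall_dotProduct_mulVec_eq_zero hGu fun x => ?_
    obtain ⟨⟨s, t⟩, rfl⟩ := κ.surjective x
    rw [hκ, add_dotProduct, he2P, ← hβ, hβz, LinearMap.zero_apply, add_zero]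
  -- the multiplier `c₀ = b`: `β(b m) = -α(m)`
  obtain ⟨b, hb⟩ := exists_forall_apply_mul_eq β hβ0 (-α)
  simp only [LinearMap.neg_apply] at hb
  have hcb : c b = b := by
    rw [← sub_eq_zero]
    refine eq_zero_of_forall_apply_mul_eq_zero β hβ0 fun m => ?_
    have h1 : β (c b * m) = -α m := by
      rw [show c b * m = c (b * c m) by rw [map_mul c, hcc], hβodd, hb, neg_neg, hαodd]
    rw [sub_mul, map_sub, hb, h1, sub_self]
  have hb0 : b ≠ 0 := by
    rintro rfl
    apply hα0
    ext m
    have h := hb m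
    rw [zero_mul, map_zero] at h
    rw [LinearMap.zero_apply, ← neg_eq_zero, ← h]
  -- the antilinear map in coordinates: `(s, t) ↦ (t̄, b s̄)`
  let ω : (K × K) →ₗ[ℚ] (K × K) :=
    { toFun := fun p => (c p.2, b * c p.1)
      map_add' := fun p q => Prod.ext (by simp) (by simp [mul_add])
      map_smul' := fun r p => Prod.ext
        (by simp only [Prod.smul_fst, Prod.smul_snd, RingHom.id_apply, AlgHom.map_smul_of_tower])
        (by simp only [Prod.smul_fst, Prod.smul_snd, RingHom.id_apply, AlgHom.map_smul_of_tower, mul_smul_comm]) }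
  let Wl : (ι → ℚ) →ₗ[ℚ] (ι → ℚ) := κ.toLinearMap ∘ₗ ω ∘ₗ κ.symm.toLinearMap
  have hW : ∀ s t, LinearMap.toMatrix' Wl *ᵥ κ (s, t) = κ (c t, b * c s) := fun s t => by
    rw [LinearMap.toMatrix'_mulVec]
    change κ (ω (κ.symm (κ (s, t)))) = _
    rw [LinearEquiv.symm_apply_apply]
    rfl
  refine ⟨LinearMap.toMatrix' Wl, b, hcb, hb0, ?_, fun a => ?_, fun a x => ?_, ?_⟩
  · -- `W² = f(b)`
    refine eq_of_forall_mulVec_eq fun x => ?_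
    obtain ⟨⟨s, t⟩, rfl⟩ := κ.surjective x
    rw [← Matrix.mulVec_mulVec, hW, hW, hfκ, map_mul c, hcb, hcc, hcc]
  · -- `W f(a) = f(ā) W`
    refine eq_of_forall_mulVec_eq fun x => ?_
    obtain ⟨⟨s, t⟩, rfl⟩ := κ.surjective x
    rw [← Matrix.mulVec_mulVec, ← Matrix.mulVec_mulVec, hfκ, hW, hW, hfκ, map_mul c, map_mul c, mul_left_comm]
  · -- `E(f(a)x, Wx) = 0`
    obtain ⟨⟨s, t⟩, rfl⟩ := κ.surjective x
    rw [hfκ, hW, hgram, hcc, map_mul c, hcb, hcc, show b * s * (a * t) = b * (t * (a * s)) by ring, hb,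
      add_neg_cancel]
  · -- `ᵗW G W = G f(b)`
    refine eq_of_forall_dotProduct_mulVec_eq fun x y => ?_
    obtain ⟨⟨s, t⟩, rfl⟩ := κ.surjective x
    obtain ⟨⟨s', t'⟩, rfl⟩ := κ.surjective y
    rw [← Matrix.mulVec_mulVec, ← Matrix.mulVec_mulVec, Matrix.dotProduct_mulVec _ (LinearMap.toMatrix' Wl)ᵀ,
      Matrix.vecMul_transpose, ← Matrix.mulVec_mulVec, hW, hW, hfκ, hgram, hgram, map_mul c, map_mul c,
      map_mul c, hcc, hcb, hcc, show b * s' * (b * c s) = b * (s' * (b * c s)) by ring, hb,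
      show b * c t' * t = b * (c t' * t) by ring, hb]
    have h1 : α (c t' * t) = -α (t' * c t) := by
      rw [show c t' * t = c (t' * c t) by rw [map_mul c, hcc], hαodd]
    have h2 : α (b * c s' * s) = -α (s' * (b * c s)) := by
      rw [show b * c s' * s = c (s' * (b * c s)) by rw [map_mul c, map_mul c, hcb, hcc]; ring, hαodd]
    rw [h1, h2]
    ring

end Construction

end AntilinearConstruction


/-! ## §2 Torus assembly: `W ∈ End_ℚ(X)` and the multiplier is totally positive -/

section Torus

open AntilinearConstruction NumberFieldAction

variable {ι : Type*} [Fintype ι] [DecidableEq ι] [Nonempty ι] {E : Type*} [NormedAddCommGroup E]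
  [NormedSpace ℂ E] [FiniteDimensional ℂ E] (Φ : (ι → ℝ) ≃L[ℝ] E) {K : Type*} [Field K] [NumberField K]
  (f : K →ₐ[ℚ] Matrix ι ι ℚ) (hf : ∀ x, f x ∈ endAlgRat Φ) {η : E [⋀^Fin 2]→L[ℝ] ℝ} {G : Matrix ι ι ℚ}

omit [Nonempty ι] [FiniteDimensional ℂ E] in
/-- The analytic representation of `K` on `T₀X` as a ring map `K → End_ℂ(T₀X)`, `y ↦ ρ_a(f y)`. [folklore] -/
private theorem tangentAction_apply (y : K) :
    (ContinuousLinearMap.toLinearMapRingHom.comp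
      ((analyticRepHom Φ).comp ((f : K →+* Matrix ι ι ℚ).codRestrict (endAlgRat Φ) hf))) y =
      ((analyticRepHom Φ ⟨f y, hf y⟩ : E →L[ℂ] E) : E →ₗ[ℂ] E) := rfl

omit [Nonempty ι] [DecidableEq ι] in
/-- Realification of a product of rational matrices. [folklore] -/
private theorem map_ratCast_mul' (A B : Matrix ι ι ℚ) :
    (A * B).map (Rat.cast : ℚ → ℝ) = A.map (Rat.cast : ℚ → ℝ) * B.map (Rat.cast : ℚ → ℝ) :=
  Matrix.map_mul (f := Rat.castHom ℝ)

omit [Nonempty ι] [DecidableEq ι] in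
/-- `ᵗ(A v) w = ᵗv (ᵗA w)`. [folklore] -/
private theorem mulVec_dotProduct_eq {R : Type*} [CommRing R] (A : Matrix ι ι R) (v w : ι → R) :
    (A *ᵥ v) ⬝ᵥ w = v ⬝ᵥ (Aᵀ *ᵥ w) := by
  rw [Matrix.dotProduct_mulVec v Aᵀ, Matrix.vecMul_transpose]

omit [Nonempty ι] in
/-- A quadratic relation `E(f(a)x, Wx) = 0` on `ℚ^ι` makes `ᵗ(f a) G W` antisymmetric, hence persists on
`ℝ^ι = Λ ⊗ ℝ`. [folklore] -/
private theorem dotProduct_map_mulVec_map_eq_zero {A W : Matrix ι ι ℚ} (h : ∀ x : ι → ℚ, (A *ᵥ x) ⬝ᵥ G *ᵥ (W *ᵥ x) = 0)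
    (x : ι → ℝ) :
    (A.map (Rat.cast : ℚ → ℝ) *ᵥ x) ⬝ᵥ G.map (Rat.cast : ℚ → ℝ) *ᵥ (W.map (Rat.cast : ℚ → ℝ) *ᵥ x) = 0 := by
  -- the rational matrix `M = ᵗA G W` is antisymmetric by polarisation
  set M : Matrix ι ι ℚ := Aᵀ * G * W with hM
  have hq : ∀ y : ι → ℚ, y ⬝ᵥ M *ᵥ y = 0 := fun y => by
    rw [hM, ← Matrix.mulVec_mulVec, ← Matrix.mulVec_mulVec, Matrix.dotProduct_mulVec y Aᵀ,
      Matrix.vecMul_transpose, h]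
  have hMt : Mᵀ = -M := by
    rw [eq_neg_iff_add_eq_zero]
    refine eq_of_forall_dotProduct_mulVec_eq fun y z => ?_
    rw [Matrix.add_mulVec, dotProduct_add, Matrix.zero_mulVec, dotProduct_zero, Matrix.mulVec_transpose,
      dotProduct_comm y (z ᵥ* M), ← Matrix.dotProduct_mulVec]
    have h1 := hq (y + z)
    rw [Matrix.mulVec_add, add_dotProduct, dotProduct_add, dotProduct_add, hq, hq, zero_add, add_zero] at h1
    rwa [add_comm] at h1
  -- transfer to `ℝ`
  have hMr : (M.map (Rat.cast : ℚ → ℝ))ᵀ = -M.map (Rat.cast : ℚ → ℝ) := by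
    rw [← Matrix.transpose_map, hMt, Matrix.map_neg _ Rat.cast_neg]
  have key : x ⬝ᵥ M.map (Rat.cast : ℚ → ℝ) *ᵥ x = 0 := by
    have h2 := dotProduct_mulVec_of_transpose_eq_neg hMr x x
    linarith
  rwa [hM, map_ratCast_mul', map_ratCast_mul', Matrix.transpose_map, ← Matrix.mulVec_mulVec,
    ← Matrix.mulVec_mulVec, Matrix.dotProduct_mulVec x, Matrix.vecMul_transpose] at key

omit [Nonempty ι] in
/-- **`W` is an endomorphism of `X`.** For a complex torus `X = E/Φ(ℤ^ι)`, a number field `K ⊆ End_ℚ(X)`,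
totally complex with an involution `c` that is complex conjugation in every embedding, a form `η` of type
`(1,1)` with invertible rational Gram matrix `G` whose Rosati involution restricts to `c` on `f(K)`, and a
rational matrix `W` with `W f(a) = f(ā) W` and `E(f(a)x, Wx) = 0`: if every tangent multiplicity is `≤ 1`
then `W ∈ End_ℚ(X)` — its real extension commutes with the complex structure, by the abstract mechanism
`NumberFieldAction.map_I_smul_of_forall_finrank_le_one` applied to `ρ_a ∘ f` on `T₀X`.
[cite: HulekLaface2019PicardNumbersAV, §5.1 Prop. 5.1 (proof, case (4))] [cite: Shimura1963AnalyticFamilies, §4 (via Hulek–Laface)] -/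
theorem mem_endAlgRat_of_antilinear (h₁₁ : ∀ u v : E, η ![I • u, I • v] = η ![u, v])
    (hGu : IsUnit (latticeGram Φ η).det) (hG : G.map (Rat.cast : ℚ → ℝ) = latticeGram Φ η)
    (c : K →ₐ[ℚ] K) (hc : ∀ (φ : K →+* ℂ) (a : K), φ (c a) = conj (φ a)) (hcc : ∀ a, c (c a) = a)
    (htc : ∀ φ : K →+* ℂ, ¬ ComplexEmbedding.IsReal φ) (hros : ∀ a, rosati G (f a) = f (c a))
    {W : Matrix ι ι ℚ} (hWa : ∀ a, W * f a = f (c a) * W) (hWo : ∀ a x, (f a *ᵥ x) ⬝ᵥ G *ᵥ (W *ᵥ x) = 0)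
    (hmult : ∀ σ : K →+* ℂ, finrank ℂ ↥(⨅ y : K,
      Module.End.eigenspace ((analyticRepHom Φ ⟨f y, hf y⟩ : E →L[ℂ] E) : E →ₗ[ℂ] E) (σ y)) ≤ 1) :
    W ∈ endAlgRat Φ := by
  set Wr := W.map (Rat.cast : ℚ → ℝ) with hWr
  set T : E →L[ℝ] E := analyticRepReal Φ Φ Wr with hT
  -- the tangent action and the form `e(u, v) = η(u, v)`
  let g : K →+* Module.End ℂ E := ContinuousLinearMap.toLinearMapRingHom.comp
    ((analyticRepHom Φ).comp ((f : K →+* Matrix ι ι ℚ).codRestrict (endAlgRat Φ) hf))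
  have hg : ∀ (y : K) (x : ι → ℝ), g y (Φ x) = Φ ((f y).map (Rat.cast : ℚ → ℝ) *ᵥ x) := fun y x => by
    rw [tangentAction_apply]
    exact analyticRepHom_apply_apply Φ ⟨f y, hf y⟩ x
  let e : E →ₗ[ℝ] E →ₗ[ℝ] ℝ := LinearMap.mk₂ ℝ (fun u v => η ![u, v])
    (fun u u' v => twoForm_add_left η u u' v) (fun r u v => twoForm_smul_left η r u v)
    (fun u v v' => twoForm_add_right η u v v') (fun r u v => twoForm_smul_right η r u v)
  have he : ∀ u v, e u v = η ![u, v] := fun u v => rfl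
  have hTI : ∀ u, T (I • u) = I • T u := by
    refine map_I_smul_of_forall_finrank_le_one g e c hc (T : E →ₗ[ℝ] E) hcc (fun u v => ?_) (fun v hv => ?_)
      (fun a u v => ?_) (fun a w => ?_) (fun a u => ?_) htc hmult
    · rw [he, he, h₁₁]
    · obtain ⟨y, rfl⟩ := Φ.surjective v
      have hy : ∀ x : ι → ℝ, x ⬝ᵥ latticeGram Φ η *ᵥ y = 0 := fun x => by
        rw [dotProduct_latticeGram_mulVec, ← he, hv]
      rw [eq_zero_of_forall_dotProduct_mulVec_eq_zero hGu hy, map_zero]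
    · obtain ⟨x, rfl⟩ := Φ.surjective u
      obtain ⟨y, rfl⟩ := Φ.surjective v
      rw [he, he, hg, hg, twoForm_apply_mulVec_rosati_rat Φ hG hGu, hros]
    · obtain ⟨x, rfl⟩ := Φ.surjective w
      rw [hg, ContinuousLinearMap.coe_coe, hT, analyticRepReal_apply, analyticRepReal_apply, hg,
        Matrix.mulVec_mulVec, Matrix.mulVec_mulVec, hWr, ← map_ratCast_mul', ← map_ratCast_mul', hWa]
    · obtain ⟨x, rfl⟩ := Φ.surjective u
      rw [he, hg, ContinuousLinearMap.coe_coe, hT, analyticRepReal_apply, ← dotProduct_latticeGram_mulVec,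
        ← hG, hWr]
      exact dotProduct_map_mulVec_map_eq_zero (hWo a) x
  have hF : ∀ x, Φ (Wr *ᵥ x) = toComplexLinear T hTI (Φ x) := fun x => by
    rw [toComplexLinear_apply, hT, analyticRepReal_apply]
  exact (mem_endAlgRat_iff Φ W).mpr (mul_jMatrix_eq_jMatrix_mul_of_linear Φ Φ hF)

omit [Nonempty ι] [FiniteDimensional ℂ E] in
/-- A rational endomorphism commutes with `J` on vectors: `W (J x) = J (W x)`. [folklore] -/
private theorem map_mulVec_latticeJ {W : Matrix ι ι ℚ} (hW : W ∈ endAlgRat Φ) (x : ι → ℝ) :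
    W.map (Rat.cast : ℚ → ℝ) *ᵥ latticeJ Φ x = latticeJ Φ (W.map (Rat.cast : ℚ → ℝ) *ᵥ x) :=
  (mem_endAlgRat_iff_mulVec Φ W).mp hW x

include hf in
/-- **The multiplier is totally positive.** If `W ∈ End_ℚ(X)` is a similitude of the polarisation with
multiplier `f(c₀)` (`ᵗW G W = G f(c₀)`, `W² = f(c₀)`, `c̄₀ = c₀ ≠ 0`), then `φ(c₀) > 0` in every complex
embedding `φ` of `K`: on a tangent eigenvector `u` of `K` for `φ` or `φ̄` one has
`H(Wu, Wu) = φ(c₀) H(u, u)` with `H(v, v) = E(iv, v) > 0`. [cite: HulekLaface2019PicardNumbersAV, §5.1 Prop. 5.1 (proof, case (4): "totally indefinite")] -/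
theorem embedding_re_pos_of_similitude (hη : IsRiemannForm Φ η)
    (hG : G.map (Rat.cast : ℚ → ℝ) = latticeGram Φ η) (c : K →ₐ[ℚ] K)
    (hc : ∀ (φ : K →+* ℂ) (a : K), φ (c a) = conj (φ a)) {W : Matrix ι ι ℚ} (hW : W ∈ endAlgRat Φ)
    {c₀ : K} (hc₀ : c c₀ = c₀) (hc₀0 : c₀ ≠ 0) (hWW : W * W = f c₀) (hsim : Wᵀ * G * W = G * f c₀)
    (φ : K →+* ℂ) : 0 < (φ c₀).re := by
  -- a tangent eigenvector `u ≠ 0` of `K` for `τ ∈ {φ, φ̄}`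
  obtain ⟨τ, hτ, u, hu, hu0⟩ : ∃ τ : K →+* ℂ, (τ = φ ∨ τ = ComplexEmbedding.conjugate φ) ∧
      ∃ u ∈ ⨅ y : K, Module.End.eigenspace ((analyticRepHom Φ ⟨f y, hf y⟩ : E →L[ℂ] E) : E →ₗ[ℂ] E) (τ y),
        u ≠ 0 := by
    have h := finrank_iInf_eigenspace_analyticRepHom_add_conjugate_mul_finrank Φ f hf φ
    have hpos : 0 < Fintype.card ι := Fintype.card_pos
    by_cases h0 : (⨅ y : K, Module.End.eigenspace
        ((analyticRepHom Φ ⟨f y, hf y⟩ : E →L[ℂ] E) : E →ₗ[ℂ] E) (φ y)) = ⊥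
    · have h1 : (⨅ y : K, Module.End.eigenspace ((analyticRepHom Φ ⟨f y, hf y⟩ : E →L[ℂ] E) : E →ₗ[ℂ] E)
          (ComplexEmbedding.conjugate φ y)) ≠ ⊥ := by
        intro h1
        rw [h0, h1, finrank_bot, add_zero, zero_mul] at h
        omega
      obtain ⟨u, hu, hu0⟩ := Submodule.exists_mem_ne_zero_of_ne_bot h1
      exact ⟨_, Or.inr rfl, u, hu, hu0⟩
    · obtain ⟨u, hu, hu0⟩ := Submodule.exists_mem_ne_zero_of_ne_bot h0
      exact ⟨_, Or.inl rfl, u, hu, hu0⟩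
  -- `φ(c₀)` is real and `ρ_a(f c₀) u = φ(c₀) u`
  have hreal : conj (φ c₀) = φ c₀ := by rw [← hc, hc₀]
  have hτc₀ : τ c₀ = ((φ c₀).re : ℂ) := by
    rcases hτ with rfl | rfl
    · exact (conj_eq_iff_re.mp hreal).symm
    · rw [ComplexEmbedding.conjugate_coe_eq, hreal]
      exact (conj_eq_iff_re.mp hreal).symm
  have heig : (analyticRepHom Φ ⟨f c₀, hf c₀⟩ : E →L[ℂ] E) u = (φ c₀).re • u := by
    rw [Submodule.mem_iInf] at hu
    have h := Module.End.mem_eigenspace_iff.mp (hu c₀)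
    rw [ContinuousLinearMap.coe_coe, hτc₀, Complex.coe_smul] at h
    exact h
  -- read on the lattice space: `u = Φ x`, `v = W x ≠ 0`
  obtain ⟨x, rfl⟩ := Φ.surjective u
  have hx0 : x ≠ 0 := fun h => hu0 (by rw [h, map_zero])
  have hv0 : W.map (Rat.cast : ℚ → ℝ) *ᵥ x ≠ 0 := by
    intro hv
    apply hx0
    have h2 : (f c₀).map (Rat.cast : ℚ → ℝ) *ᵥ x = 0 := by
      rw [← hWW, map_ratCast_mul', ← Matrix.mulVec_mulVec, hv, Matrix.mulVec_zero]
    calc x = ((f c₀⁻¹).map (Rat.cast : ℚ → ℝ) * (f c₀).map (Rat.cast : ℚ → ℝ)) *ᵥ x := by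
          rw [← map_ratCast_mul', ← map_mul, inv_mul_cancel₀ hc₀0, map_one,
            Matrix.map_one _ Rat.cast_zero Rat.cast_one, Matrix.one_mulVec]
      _ = 0 := by rw [← Matrix.mulVec_mulVec, h2, Matrix.mulVec_zero]
  -- `H(Wu, Wu) = φ(c₀) · H(u, u)` and both `H`-values are positive
  have hpos := hη.2.2 (Φ (W.map (Rat.cast : ℚ → ℝ) *ᵥ x))
    (fun h => hv0 (Φ.injective (h.trans (map_zero Φ).symm)))
  have hsimr : (W.map (Rat.cast : ℚ → ℝ))ᵀ * G.map (Rat.cast : ℚ → ℝ) * W.map (Rat.cast : ℚ → ℝ) =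
      G.map (Rat.cast : ℚ → ℝ) * (f c₀).map (Rat.cast : ℚ → ℝ) := by
    rw [← Matrix.transpose_map, ← map_ratCast_mul', ← map_ratCast_mul', hsim, map_ratCast_mul']
  have hkey : η ![I • Φ (W.map (Rat.cast : ℚ → ℝ) *ᵥ x), Φ (W.map (Rat.cast : ℚ → ℝ) *ᵥ x)] =
      (φ c₀).re * η ![I • Φ x, Φ x] := by
    rw [← apply_latticeJ, ← map_mulVec_latticeJ Φ hW, ← dotProduct_latticeGram_mulVec, ← hG,
      Matrix.mulVec_mulVec, mulVec_dotProduct_eq, Matrix.mulVec_mulVec, ← Matrix.mul_assoc, hsimr,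
      ← Matrix.mulVec_mulVec, hG, dotProduct_latticeGram_mulVec, apply_latticeJ,
      ← analyticRepHom_apply_apply Φ ⟨f c₀, hf c₀⟩, heig, twoForm_smul_right]
  rw [hkey] at hpos
  exact (mul_pos_iff_of_pos_right (hη.2.2 (Φ x) hu0)).mp hpos

/-- **Hulek–Laface Prop. 5.1 / Shimura 1963 §4, exceptional case (4), at torus level — the antilinear
endomorphism.** Let `X = E/Φ(ℤ^ι)` be a complex torus with a polarisation `η` (rational Gram matrix `G`),
`K` a CM field with `[K : ℚ] = dim X` («`d = 1`, `m = 2`») embedded in `End_ℚ(X)` by `f`, Rosati-stable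
(`(f x)′ ∈ f(K)`), acting on `T₀X` with ALL MULTIPLICITIES ONE (`n_σ = 1` for every `σ : K → ℂ`, «`r_ν = s_ν = 1`
for all `ν`»). Then there is `W ∈ End_ℚ(X)`, `K`-ANTILINEAR (`W f(a) = f(ā) W`), with `W² = f(c₀)` for some
`c₀ ∈ K₀ = K⁺`, `c₀ ≠ 0`, TOTALLY POSITIVE (`φ(c₀) > 0` for all `φ`), a similitude of the polarisation
(`ᵗW G W = G f(c₀)`) mapping every `K`-line of `H₁(X, ℚ)` into its `E`-orthogonal; `f(K) ⊕ f(K)W` is then the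
totally indefinite quaternion algebra `F̃ ⊋ f(K)` of the source (`exists_quaternionAlgebra_hom_of_forall_finrank_eq_one`).
[cite: HulekLaface2019PicardNumbersAV, §5.1 Prop. 5.1 (proof, case (4): "`End_ℚ(X)` contains a totally indefinite quaternion algebra `F̃` over `K₀` with `F = K ⊂ F̃`")]
[cite: Shimura1963AnalyticFamilies, §4 (via Hulek–Laface)] -/
theorem exists_antilinear_mem_endAlgRat_of_forall_finrank_eq_one [IsCMField K] (hη : IsRiemannForm Φ η)
    (hG : G.map (Rat.cast : ℚ → ℝ) = latticeGram Φ η) (hst : ∀ x, ∃ y, rosati G (f x) = f y)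
    (hK : finrank ℚ K = finrank ℂ E)
    (h1 : ∀ σ : K →+* ℂ, finrank ℂ ↥(⨅ y : K,
      Module.End.eigenspace ((analyticRepHom Φ ⟨f y, hf y⟩ : E →L[ℂ] E) : E →ₗ[ℂ] E) (σ y)) = 1) :
    ∃ (W : Matrix ι ι ℚ) (c₀ : K), W ∈ endAlgRat Φ ∧ IsCMField.complexConj K c₀ = c₀ ∧ c₀ ≠ 0 ∧
      W * W = f c₀ ∧ (∀ a, W * f a = f (IsCMField.complexConj K a) * W) ∧
      (∀ φ : K →+* ℂ, 0 < (φ c₀).re) ∧ Wᵀ * G * W = G * f c₀ ∧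
      (∀ a x, (f a *ᵥ x) ⬝ᵥ G *ᵥ (W *ᵥ x) = 0) := by
  -- complex conjugation as a `ℚ`-algebra map, and its properties
  let c : K →ₐ[ℚ] K := (IsCMField.complexConj K : K →+* K).toRatAlgHom
  have hcK : ∀ a, c a = IsCMField.complexConj K a := fun a => rfl
  have hc : ∀ (φ : K →+* ℂ) (a : K), φ (c a) = conj (φ a) := fun φ a => by
    rw [hcK, IsCMField.complexEmbedding_complexConj]
  have hcc : ∀ a, c (c a) = a := fun a => by rw [hcK, hcK, IsCMField.complexConj_apply_apply]
  have hc1 : ∃ a, c a ≠ a := by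
    by_contra h
    simp only [ne_eq, not_exists, not_not] at h
    exact IsCMField.complexConj_ne_one K (AlgEquiv.ext fun a => (hcK a).symm.trans (h a))
  haveI := IsCMField.isTotallyComplex K
  have htc : ∀ φ : K →+* ℂ, ¬ ComplexEmbedding.IsReal φ := fun φ =>
    IsTotallyComplex.complexEmbedding_not_isReal φ
  have hGu := hη.isUnit_det_latticeGram
  have hGu' : IsUnit G.det := isUnit_det_of_map_ratCast hG hGu
  have hGt : Gᵀ = -G := transpose_eq_neg_of_map_ratCast Φ hG
  have hros : ∀ a, rosati G (f a) = f (c a) := fun a => by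
    rw [hcK]; exact rosati_algHom_eq_complexConj Φ hη.1 hη.2.2 hG f hf hst a
  have hcard : Fintype.card ι = 2 * finrank ℚ K := by rw [hK, card_eq_two_mul_finrank Φ]
  obtain ⟨W, c₀, hc₀, hc₀0, hWW, hWa, hWo, hsim⟩ :=
    exists_antilinear_matrix f c hGt hGu' hros hcc hc1 hcard
  have hW : W ∈ endAlgRat Φ :=
    mem_endAlgRat_of_antilinear Φ f hf hη.1 hGu hG c hc hcc htc hros hWa hWo (fun σ => (h1 σ).le)
  refine ⟨W, c₀, hW, (hcK c₀) ▸ hc₀, hc₀0, hWW, fun a => (hcK a) ▸ hWa a, fun φ => ?_, hsim, hWo⟩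
  exact embedding_re_pos_of_similitude Φ f hf hη hG c hc hW hc₀ hc₀0 hWW hsim φ

end Torus

/-! ## §3 The totally indefinite quaternion algebra `F̃ = f(K) ⊕ f(K)W ≅ ℍ[K⁺, θ², c₀]` inside `End_ℚ(X)` -/

section Quaternion

open Literature.NumberTheory.Automorphic (IsQuaternionAlgebra IsSplitAtInfinite)
open Literature.RingTheory.CentralSimple (IsTotallyIndefinite)

variable {ι : Type*} [Fintype ι] [DecidableEq ι] [Nonempty ι] {K : Type} [Field K] [NumberField K] [IsCMField K]
  (f : K →ₐ[ℚ] Matrix ι ι ℚ)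

local notation3 "K⁺" => maximalRealSubfield K

/-- **The quaternion algebra generated by `K` and an antilinear `W`.** For a CM field `K ↪ M_ι(ℚ)` (via `f`),
`θ ∈ K` purely imaginary (`θ̄ = -θ ≠ 0`) and a matrix `W` with `W f(a) = f(ā) W`, `W² = f(c₀)`,
`c₀ ∈ K⁺ \ {0}`: the map `ℍ[K⁺, θ², c₀] → M_ι(ℚ)`, `z₁ + z₂ j ↦ f(z₁) + f(z₂) W`
(`z₁ = r + sθ`, `z₂ = t + uθ`; `i ↦ f(θ)`, `j ↦ W`) is an INJECTIVE `ℚ`-algebra homomorphism whose range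
contains `f(K)` and `W` — the cyclic algebra `(K/K⁺, ¯, c₀) = f(K) ⊕ f(K)W`. [cite: HulekLaface2019PicardNumbersAV, §5.1 Prop. 5.1 (proof, case (4): "`F̃` … with `F = K ⊂ F̃`")] -/
theorem exists_quaternionAlgebra_algHom {θ : K} (hθ : IsCMField.complexConj K θ = -θ) (hθ0 : θ ≠ 0)
    {W : Matrix ι ι ℚ} {c₀ : K} (hc₀ : IsCMField.complexConj K c₀ = c₀) (hc₀0 : c₀ ≠ 0)
    (hWW : W * W = f c₀) (hWa : ∀ a, W * f a = f (IsCMField.complexConj K a) * W) :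
    ∃ (hα : θ * θ ∈ K⁺) (hc : c₀ ∈ K⁺) (Ψ : ℍ[K⁺, (⟨θ * θ, hα⟩ : K⁺), (⟨c₀, hc⟩ : K⁺)] →ₐ[ℚ] Matrix ι ι ℚ),
      Function.Injective Ψ ∧ (∀ q, Ψ q = f ((q.re : K) + (q.imI : K) * θ) + f ((q.imJ : K) + (q.imK : K) * θ) * W) ∧
      (∀ a : K, ∃ q, Ψ q = f a) ∧ (∃ q, Ψ q = W) := by
  have hα : θ * θ ∈ K⁺ := by
    rw [← IsCMField.complexConj_eq_self_iff, map_mul, hθ, neg_mul_neg]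
  have hc : c₀ ∈ K⁺ := (IsCMField.complexConj_eq_self_iff K c₀).mp hc₀
  refine ⟨hα, hc, ?_⟩
  set cj := IsCMField.complexConj K with hcj
  have hfix : ∀ r : K⁺, cj (r : K) = r := fun r => IsCMField.complexConj_apply_eq_self K r
  -- the coordinates `Z₁ = r + sθ`, `Z₂ = t + uθ` and their multiplicativity
  let Z₁ : ℍ[K⁺, (⟨θ * θ, hα⟩ : K⁺), (⟨c₀, hc⟩ : K⁺)] → K := fun q => (q.re : K) + (q.imI : K) * θ
  let Z₂ : ℍ[K⁺, (⟨θ * θ, hα⟩ : K⁺), (⟨c₀, hc⟩ : K⁺)] → K := fun q => (q.imJ : K) + (q.imK : K) * θ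
  have hZ₁ : ∀ p q, Z₁ (p * q) = Z₁ p * Z₁ q + c₀ * (Z₂ p * cj (Z₂ q)) := by
    intro p q
    simp only [Z₁, Z₂, QuaternionAlgebra.re_mul, QuaternionAlgebra.imI_mul, map_add, map_mul, hfix, hθ]
    push_cast
    ring
  have hZ₂ : ∀ p q, Z₂ (p * q) = Z₁ p * Z₂ q + Z₂ p * cj (Z₁ q) := by
    intro p q
    simp only [Z₁, Z₂, QuaternionAlgebra.imJ_mul, QuaternionAlgebra.imK_mul, map_add, map_mul, hfix, hθ]
    push_cast
    ring
  -- multiplication in `f(K) ⊕ f(K) W`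
  have hmul : ∀ a b a' b' : K, (f a + f b * W) * (f a' + f b' * W) =
      f (a * a' + c₀ * (b * cj b')) + f (a * b' + b * cj a') * W := by
    intro a b a' b'
    calc (f a + f b * W) * (f a' + f b' * W)
        = f a * f a' + f a * f b' * W + f b * (W * f a') + f b * (W * f b') * W := by noncomm_ring
      _ = f a * f a' + f a * f b' * W + f b * (f (cj a') * W) + f b * (f (cj b') * W) * W := by
          rw [hWa a', hWa b']
      _ = f (a * a') + f (a * b') * W + f (b * cj a') * W + f (b * cj b') * (W * W) := by
          rw [map_mul, map_mul, map_mul, map_mul]; noncomm_ring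
      _ = f (a * a' + c₀ * (b * cj b')) + f (a * b' + b * cj a') * W := by
          rw [hWW, ← map_mul, map_add, map_add, mul_comm c₀, add_mul]; abel
  let Ψ₀ : ℍ[K⁺, (⟨θ * θ, hα⟩ : K⁺), (⟨c₀, hc⟩ : K⁺)] →+* Matrix ι ι ℚ :=
    { toFun := fun q => f (Z₁ q) + f (Z₂ q) * W
      map_one' := by
        have h1 : Z₁ 1 = 1 := by
          simp only [Z₁, QuaternionAlgebra.re_one, QuaternionAlgebra.imI_one]; push_cast; ring
        have h2 : Z₂ 1 = 0 := by
          simp only [Z₂, QuaternionAlgebra.imJ_one, QuaternionAlgebra.imK_one]; push_cast; ring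
        rw [h1, h2, map_one, map_zero, zero_mul, add_zero]
      map_mul' := fun p q => by
        show f (Z₁ (p * q)) + f (Z₂ (p * q)) * W = (f (Z₁ p) + f (Z₂ p) * W) * (f (Z₁ q) + f (Z₂ q) * W)
        rw [hZ₁, hZ₂, hmul]
      map_zero' := by
        have h1 : Z₁ 0 = 0 := by
          simp only [Z₁, QuaternionAlgebra.re_zero, QuaternionAlgebra.imI_zero]; push_cast; ring
        have h2 : Z₂ 0 = 0 := by
          simp only [Z₂, QuaternionAlgebra.imJ_zero, QuaternionAlgebra.imK_zero]; push_cast; ring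
        rw [h1, h2, map_zero, zero_mul, add_zero]
      map_add' := fun p q => by
        have h1 : Z₁ (p + q) = Z₁ p + Z₁ q := by
          simp only [Z₁, QuaternionAlgebra.re_add, QuaternionAlgebra.imI_add]; push_cast; ring
        have h2 : Z₂ (p + q) = Z₂ p + Z₂ q := by
          simp only [Z₂, QuaternionAlgebra.imJ_add, QuaternionAlgebra.imK_add]; push_cast; ring
        show f (Z₁ (p + q)) + f (Z₂ (p + q)) * W = (f (Z₁ p) + f (Z₂ p) * W) + (f (Z₁ q) + f (Z₂ q) * W)
        rw [h1, h2, map_add f (Z₁ p) (Z₁ q), map_add f (Z₂ p) (Z₂ q), add_mul]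
        abel }
  have hΨ : ∀ q, Ψ₀.toRatAlgHom q = f (Z₁ q) + f (Z₂ q) * W := fun q => rfl
  -- `r + sθ = 0` with `r, s ∈ K⁺` forces `r = s = 0`
  have hdec : ∀ r s : K⁺, (r : K) + (s : K) * θ = 0 → r = 0 ∧ s = 0 := by
    intro r s h
    have h' : (r : K) - (s : K) * θ = 0 := by
      have := congrArg cj h
      rwa [map_add, map_mul, hfix, hfix, hθ, map_zero, mul_neg, ← sub_eq_add_neg] at this
    have hr : (r : K) = 0 := by linear_combination (h + h') / 2
    have hs : (s : K) = 0 := by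
      have : (s : K) * θ = 0 := by linear_combination (h - h') / 2
      exact (mul_eq_zero.mp this).resolve_right hθ0
    exact ⟨ZeroMemClass.coe_eq_zero.mp hr, ZeroMemClass.coe_eq_zero.mp hs⟩
  have hfinj := AntilinearConstruction.algHom_injective f
  refine ⟨Ψ₀.toRatAlgHom, ?_, hΨ, fun a => ?_, ?_⟩
  · -- injectivity: `f(a) + f(b)W = 0` ⟹ `b = 0` (conjugate by `f(θ)`) ⟹ `a = 0`
    refine (injective_iff_map_eq_zero _).mpr fun q hq => ?_
    rw [hΨ] at hq
    have hb : Z₂ q = 0 := by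
      have h1 : f θ * f (Z₁ q) = f (Z₁ q) * f θ := by rw [← map_mul, ← map_mul, mul_comm]
      rw [eq_neg_of_add_eq_zero_left hq, mul_neg, neg_mul, neg_inj, ← mul_assoc, ← map_mul, mul_assoc,
        hWa θ, hθ, map_neg, neg_mul, mul_neg, ← mul_assoc, ← map_mul] at h1
      -- `h1 : f (θ b) W = -(f (b θ) W)`
      have h2 : f ((θ * Z₂ q + Z₂ q * θ) * c₀) = 0 := by
        rw [map_mul, ← hWW, ← mul_assoc, map_add, add_mul, h1, neg_add_cancel, zero_mul]
      have h3 : (θ * Z₂ q + Z₂ q * θ) * c₀ = 0 := hfinj (h2.trans (map_zero f).symm)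
      have h4 : θ * Z₂ q + Z₂ q * θ = 0 := (mul_eq_zero.mp h3).resolve_right hc₀0
      have h5 : (2 * θ) * Z₂ q = 0 := by linear_combination h4
      exact (mul_eq_zero.mp h5).resolve_left (mul_ne_zero two_ne_zero hθ0)
    have ha : Z₁ q = 0 := by
      rw [hb, map_zero, zero_mul, add_zero] at hq
      exact hfinj (hq.trans (map_zero f).symm)
    obtain ⟨h₁, h₂⟩ := hdec q.re q.imI ha
    obtain ⟨h₃, h₄⟩ := hdec q.imJ q.imK hb
    exact QuaternionAlgebra.ext h₁ h₂ h₃ h₄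
  · -- `f(K) ⊆ range Ψ`: `a = r + sθ` with `r = (a + ā)/2`, `s = (a - ā)/(2θ)` in `K⁺`
    have hcc' : ∀ b, cj (cj b) = b := fun b => IsCMField.complexConj_apply_apply K b
    have h2 : cj 2 = 2 := map_ofNat cj 2
    have hr : (a + cj a) / 2 ∈ K⁺ := by
      rw [← IsCMField.complexConj_eq_self_iff, ← hcj, map_div₀, map_add, h2, hcc', add_comm]
    have hs : (a - cj a) / (2 * θ) ∈ K⁺ := by
      rw [← IsCMField.complexConj_eq_self_iff, ← hcj, map_div₀, map_sub, map_mul, h2, hcc', hθ,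
        mul_neg, div_neg, ← neg_div, neg_sub]
    have hZ1 : Z₁ ⟨⟨_, hr⟩, ⟨_, hs⟩, 0, 0⟩ = a := by
      change (a + cj a) / 2 + (a - cj a) / (2 * θ) * θ = a
      field_simp
      ring
    have hZ2 : Z₂ ⟨⟨_, hr⟩, ⟨_, hs⟩, 0, 0⟩ = 0 := by
      change ((0 : K⁺) : K) + ((0 : K⁺) : K) * θ = 0
      push_cast
      ring
    exact ⟨⟨⟨_, hr⟩, ⟨_, hs⟩, 0, 0⟩, by rw [hΨ, hZ1, hZ2, map_zero, zero_mul, add_zero]⟩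
  · have hZ1 : Z₁ ⟨0, 0, 1, 0⟩ = 0 := by
      change ((0 : K⁺) : K) + ((0 : K⁺) : K) * θ = 0
      push_cast
      ring
    have hZ2 : Z₂ ⟨0, 0, 1, 0⟩ = 1 := by
      change ((1 : K⁺) : K) + ((0 : K⁺) : K) * θ = 1
      push_cast
      ring
    exact ⟨⟨0, 0, 1, 0⟩, by rw [hΨ, hZ1, hZ2, map_zero, map_one, one_mul, zero_add]⟩

omit [Nonempty ι] [IsCMField K] in
/-- An antilinear `W` with `W² = f(c₀)`, `c₀ ≠ 0`, is not in `f(K)` (conjugating `f(θ)`, `θ̄ = -θ ≠ 0`, would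
give `2θ a = 0`). [cite: HulekLaface2019PicardNumbersAV, §5.1 Prop. 5.1 (proof, case (4): "`F = K ⊂ F̃`")] -/
theorem forall_algHom_ne_of_antilinear [Nonempty ι] {c : K →ₐ[ℚ] K} {θ : K} (hθ : c θ = -θ) (hθ0 : θ ≠ 0)
    {W : Matrix ι ι ℚ} {c₀ : K} (hc₀0 : c₀ ≠ 0) (hWW : W * W = f c₀) (hWa : ∀ a, W * f a = f (c a) * W)
    (a : K) : f a ≠ W := by
  intro haW
  have hfinj := AntilinearConstruction.algHom_injective f
  have h1 := hWa θ
  rw [← haW, ← map_mul, ← map_mul, hθ] at h1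
  have h2 : a * θ = -θ * a := hfinj h1
  have h3 : (2 * θ) * a = 0 := by linear_combination h2
  have ha : a = 0 := (mul_eq_zero.mp h3).resolve_left (mul_ne_zero two_ne_zero hθ0)
  rw [ha, map_zero] at haW
  apply hc₀0
  apply hfinj
  rw [← hWW, ← haW, mul_zero, map_zero]

/-- **Hulek–Laface Prop. 5.1, exceptional case (4), AS PRINTED, in every dimension, at torus level:**
«`F` is of type IV, `m := g/d²e₀ = 2`, `d = 1` and `r_ν = s_ν = 1` for all `ν` … `End_ℚ(X)` contains a
totally indefinite quaternion algebra `F̃` over `K₀` with `F = K ⊂ F̃`». For a polarised complex torus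
`(X = E/Φ(ℤ^ι), η)`, a CM field `K` with `[K : ℚ] = dim X`, Rosati-stably embedded by `f` in `End_ℚ(X)` with all
tangent multiplicities `n_σ = 1`: there are `α, c₀ ∈ K⁺ = K₀` and an INJECTIVE `ℚ`-algebra homomorphism
`Ψ : ℍ[K⁺, α, c₀] → M_ι(ℚ)` with image in `End_ℚ(X)`, whose image contains `f(K)` and an element outside
`f(K)`, where `ℍ[K⁺, α, c₀]` is a quaternion algebra over `K⁺` (`IsQuaternionAlgebra`) split at every (real)
place of `K⁺` (`IsTotallyIndefinite`). [cite: HulekLaface2019PicardNumbersAV, §5.1 Prop. 5.1 exceptional case (4) and proof]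
[cite: Shimura1963AnalyticFamilies, §4 (via Hulek–Laface)] -/
theorem exists_totallyIndefinite_quaternionAlgebra_of_forall_finrank_eq_one {E : Type*} [NormedAddCommGroup E]
    [NormedSpace ℂ E] [FiniteDimensional ℂ E] (Φ : (ι → ℝ) ≃L[ℝ] E) (hf : ∀ x, f x ∈ endAlgRat Φ)
    {η : E [⋀^Fin 2]→L[ℝ] ℝ} (hη : IsRiemannForm Φ η) {G : Matrix ι ι ℚ}
    (hG : G.map (Rat.cast : ℚ → ℝ) = latticeGram Φ η) (hst : ∀ x, ∃ y, rosati G (f x) = f y)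
    (hK : finrank ℚ K = finrank ℂ E)
    (h1 : ∀ σ : K →+* ℂ, finrank ℂ ↥(⨅ y : K,
      Module.End.eigenspace ((analyticRepHom Φ ⟨f y, hf y⟩ : E →L[ℂ] E) : E →ₗ[ℂ] E) (σ y)) = 1) :
    ∃ (α c₀ : K⁺) (Ψ : ℍ[K⁺, α, c₀] →ₐ[ℚ] Matrix ι ι ℚ),
      IsQuaternionAlgebra K⁺ ℍ[K⁺, α, c₀] ∧ IsTotallyIndefinite K⁺ ℍ[K⁺, α, c₀] ∧
      Function.Injective Ψ ∧ (∀ q, Ψ q ∈ endAlgRat Φ) ∧ (∀ a : K, ∃ q, Ψ q = f a) ∧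
      (∃ q, ∀ a : K, f a ≠ Ψ q) := by
  obtain ⟨W, c₀, hW, hc₀, hc₀0, hWW, hWa, hpos, -, -⟩ :=
    exists_antilinear_mem_endAlgRat_of_forall_finrank_eq_one Φ f hf hη hG hst hK h1
  -- a purely imaginary `θ ≠ 0`
  obtain ⟨a, ha⟩ : ∃ a, IsCMField.complexConj K a ≠ a := by
    by_contra h
    simp only [ne_eq, not_exists, not_not] at h
    exact IsCMField.complexConj_ne_one K (AlgEquiv.ext h)
  set θ := a - IsCMField.complexConj K a with hθdef
  have hθ : IsCMField.complexConj K θ = -θ := by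
    rw [hθdef, map_sub, IsCMField.complexConj_apply_apply, neg_sub]
  have hθ0 : θ ≠ 0 := fun h => ha (sub_eq_zero.mp h).symm
  obtain ⟨hα, hc, Ψ, hinj, hΨ, hK', hWq⟩ := exists_quaternionAlgebra_algHom f hθ hθ0 hc₀ hc₀0 hWW hWa
  have hα0 : (⟨θ * θ, hα⟩ : K⁺) ≠ 0 := fun h => mul_ne_zero hθ0 hθ0 (congrArg Subtype.val h)
  have hc0' : (⟨c₀, hc⟩ : K⁺) ≠ 0 := fun h => hc₀0 (congrArg Subtype.val h)
  refine ⟨⟨θ * θ, hα⟩, ⟨c₀, hc⟩, Ψ, ?_, ⟨fun w => ?_⟩, hinj, fun q => ?_, hK', ?_⟩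
  · exact Literature.NumberTheory.Automorphic.QuaternionAlgebra.isQuaternionAlgebra_holds hα0 hc0'
  · -- split at the real place `w`: the embedding of `c₀` is positive
    have hw : w.IsReal := IsTotallyReal.isReal w
    by_contra hns
    rw [Literature.RingTheory.CentralSimple.not_isSplitAtInfinite_quaternionAlgebra_iff_of_isReal
      (K := K⁺) hα0 hc0' hw] at hns
    -- extend `w` to a complex embedding of `K`
    letI : Algebra K⁺ ℂ := (w.embedding).toAlgebra
    let φ : K →+* ℂ := (IsAlgClosed.lift (R := K⁺) (M := ℂ) (S := K)).toRingHom
    have hφ : φ c₀ = w.embedding ⟨c₀, hc⟩ :=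
      (IsAlgClosed.lift (R := K⁺) (M := ℂ) (S := K)).commutes ⟨c₀, hc⟩
    have h := hpos φ
    rw [hφ, ← InfinitePlace.embedding_of_isReal_apply hw, Complex.ofReal_re] at h
    exact lt_asymm h hns.2
  · rw [hΨ]
    exact Subalgebra.add_mem _ (hf _) (Subalgebra.mul_mem _ (hf _) hW)
  · obtain ⟨q, hq⟩ := hWq
    refine ⟨q, fun b => ?_⟩
    rw [hq]
    exact forall_algHom_ne_of_antilinear f (c := (IsCMField.complexConj K : K →+* K).toRatAlgHom) hθ hθ0 hc₀0
      hWW hWa b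

end Quaternion

/-! ## §4 Corollaries: `End_ℚ(X) ⊋ f(K)`, `dim_ℚ End_ℚ(X) ≥ 2 dim X`, non-occurrence, the junction with case (3) -/

section Corollaries

open Literature.NumberTheory.Automorphic (IsQuaternionAlgebra)
open Literature.RingTheory.CentralSimple (IsTotallyIndefinite)

variable {ι : Type} [Fintype ι] [DecidableEq ι] [Nonempty ι] {E : Type} [NormedAddCommGroup E]
  [NormedSpace ℂ E] [FiniteDimensional ℂ E] (Φ : (ι → ℝ) ≃L[ℝ] E) {K : Type} [Field K] [NumberField K]
  [IsCMField K] (f : K →ₐ[ℚ] Matrix ι ι ℚ) (hf : ∀ x, f x ∈ endAlgRat Φ) {η : E [⋀^Fin 2]→L[ℝ] ℝ}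
  {G : Matrix ι ι ℚ}

local notation3 "K⁺" => maximalRealSubfield K

/-- **`End_ℚ(X) ⊋ f(K)`** under the hypotheses of case (4): there is an endomorphism outside `f(K)` («so that
`F = K ⊂ F̃ ⊂ End_ℚ(X) = F`, contradiction» — here the positive content). [cite: HulekLaface2019PicardNumbersAV, §5.1 Prop. 5.1 (proof, case (4))] -/
theorem exists_mem_endAlgRat_forall_ne_of_forall_finrank_eq_one (hη : IsRiemannForm Φ η)
    (hG : G.map (Rat.cast : ℚ → ℝ) = latticeGram Φ η) (hst : ∀ x, ∃ y, rosati G (f x) = f y)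
    (hK : finrank ℚ K = finrank ℂ E)
    (h1 : ∀ σ : K →+* ℂ, finrank ℂ ↥(⨅ y : K,
      Module.End.eigenspace ((analyticRepHom Φ ⟨f y, hf y⟩ : E →L[ℂ] E) : E →ₗ[ℂ] E) (σ y)) = 1) :
    ∃ W ∈ endAlgRat Φ, ∀ a, f a ≠ W := by
  obtain ⟨α, c₀, Ψ, -, -, -, hΨE, -, q, hq⟩ :=
    exists_totallyIndefinite_quaternionAlgebra_of_forall_finrank_eq_one f Φ hf hη hG hst hK h1
  exact ⟨Ψ q, hΨE q, hq⟩

/-- **`dim_ℚ End_ℚ(X) ≥ 2 dim X`** under the hypotheses of case (4): `End_ℚ(X)` contains the image of the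
`2[K:ℚ] = 2g`-dimensional `F̃`. [cite: HulekLaface2019PicardNumbersAV, §5.1 Prop. 5.1 (proof, case (4))] -/
theorem card_le_finrank_endAlgRat_of_forall_finrank_eq_one (hη : IsRiemannForm Φ η)
    (hG : G.map (Rat.cast : ℚ → ℝ) = latticeGram Φ η) (hst : ∀ x, ∃ y, rosati G (f x) = f y)
    (hK : finrank ℚ K = finrank ℂ E)
    (h1 : ∀ σ : K →+* ℂ, finrank ℂ ↥(⨅ y : K,
      Module.End.eigenspace ((analyticRepHom Φ ⟨f y, hf y⟩ : E →L[ℂ] E) : E →ₗ[ℂ] E) (σ y)) = 1) :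
    Fintype.card ι ≤ finrank ℚ ↥(endAlgRat Φ) := by
  obtain ⟨α, c₀, Ψ, -, -, hinj, hΨE, -, -⟩ :=
    exists_totallyIndefinite_quaternionAlgebra_of_forall_finrank_eq_one f Φ hf hη hG hst hK h1
  have hdim : finrank ℚ ℍ[K⁺, α, c₀] = Fintype.card ι := by
    have h4 := QuaternionAlgebra.finrank_eq_four α (0 : K⁺) c₀
    have hKK : finrank ℚ K⁺ * 2 = finrank ℚ K := by
      rw [← Algebra.IsQuadraticExtension.finrank_eq_two K⁺ K, Module.finrank_mul_finrank]
    rw [← Module.finrank_mul_finrank ℚ K⁺ ℍ[K⁺, α, c₀], h4, card_eq_two_mul_finrank Φ, ← hK, ← hKK]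
    ring
  have hinj' : Function.Injective Ψ.toLinearMap := fun x y h => hinj h
  calc Fintype.card ι = finrank ℚ ℍ[K⁺, α, c₀] := hdim.symm
    _ = finrank ℚ ↥(LinearMap.range Ψ.toLinearMap) := (LinearMap.finrank_range_of_inj hinj').symm
    _ ≤ finrank ℚ ↥(Subalgebra.toSubmodule (endAlgRat Φ)) :=
        Submodule.finrank_mono (by rintro _ ⟨q, rfl⟩; exact hΨE q)
    _ = finrank ℚ ↥(endAlgRat Φ) := rfl

/-- **NON-OCCURRENCE (Hulek–Laface: «under the assumption that our abelian variety `X` be simple … these cases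
never occur», case (4), in every dimension).** No polarised complex torus `X` has `End_ℚ(X) = f(K) ≅ K` a CM
field with `[K : ℚ] = dim X` acting on `T₀X` with all multiplicities `n_σ = 1`: if `End_ℚ(X) = f(K)` (then
Rosati-stability is automatic) and `[K : ℚ] = dim X`, SOME multiplicity is `≠ 1`. For `X` simple of type IV with
`d = 1`, `m = 2` this is the printed exclusion of «`r_ν = s_ν = 1` for all `ν`».
[cite: HulekLaface2019PicardNumbersAV, §5.1 Prop. 5.1 exceptional case (4) and proof ("`F = K ⊂ F̃ ⊂ End_ℚ(X) = F`, contradiction")]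
[cite: Shimura1963AnalyticFamilies, §4 (via Hulek–Laface)] -/
theorem exists_finrank_ne_one_of_range_eq_endAlgRat (hη : IsRiemannForm Φ η)
    (hG : G.map (Rat.cast : ℚ → ℝ) = latticeGram Φ η) (hfE : f.range = endAlgRat Φ)
    (hK : finrank ℚ K = finrank ℂ E) :
    ∃ σ : K →+* ℂ, finrank ℂ ↥(⨅ y : K,
      Module.End.eigenspace ((analyticRepHom Φ ⟨f y, hf y⟩ : E →L[ℂ] E) : E →ₗ[ℂ] E) (σ y)) ≠ 1 := by
  by_contra h
  simp only [ne_eq, not_exists, not_not] at h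
  have hst := exists_rosati_eq_of_range_eq_endAlgRat Φ hη.1 hη.2.2 hG f hfE
  obtain ⟨W, hW, hne⟩ := exists_mem_endAlgRat_forall_ne_of_forall_finrank_eq_one Φ f hf hη hG hst hK h
  rw [← hfE, AlgHom.mem_range] at hW
  obtain ⟨a, ha⟩ := hW
  exact hne a ha

/-- **Junction with case (3) for SIMPLE `X`: the signature of `K = End_ℚ(X)` is neither all-one nor pure.**
For a simple polarised complex torus whose endomorphism algebra is a CM field `K` with `[K : ℚ] = dim X`
(`m = 2`), the tangent multiplicities are not all `1` (case (4), this file) and not pure — some `σ` has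
`n_σ ≠ 0 ≠ n_σ̄` (case (3): purity would give `[K : ℚ] = 2 dim X`, the tree's
`IsSimple.finrank_eq_card_and_range_eq_of_forall_finrank_eq_zero`). At `dim X = 2` (`n_σ + n_σ̄ = 2`) the two
exclusions are contradictory — the tree's `ComplexTorusAbelianSurfaceShimura` (no imaginary quadratic `End_ℚ`
for a simple abelian surface), by another route. [cite: HulekLaface2019PicardNumbersAV, §5.1 Prop. 5.1 exceptional cases (3), (4) and proof]
[cite: Shimura1963AnalyticFamilies, §4 (via Hulek–Laface)] -/
theorem IsSimple.exists_finrank_ne_one_and_exists_ne_zero_of_range_eq_endAlgRat (hX : IsSimple Φ)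
    (hη : IsRiemannForm Φ η) (hG : G.map (Rat.cast : ℚ → ℝ) = latticeGram Φ η) (hfE : f.range = endAlgRat Φ)
    (hK : finrank ℚ K = finrank ℂ E) :
    (∃ σ : K →+* ℂ, finrank ℂ ↥(⨅ y : K,
      Module.End.eigenspace ((analyticRepHom Φ ⟨f y, hf y⟩ : E →L[ℂ] E) : E →ₗ[ℂ] E) (σ y)) ≠ 1) ∧
    (∃ σ : K →+* ℂ, finrank ℂ ↥(⨅ y : K,
      Module.End.eigenspace ((analyticRepHom Φ ⟨f y, hf y⟩ : E →L[ℂ] E) : E →ₗ[ℂ] E) (σ y)) ≠ 0 ∧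
      finrank ℂ ↥(⨅ y : K, Module.End.eigenspace ((analyticRepHom Φ ⟨f y, hf y⟩ : E →L[ℂ] E) : E →ₗ[ℂ] E)
        (ComplexEmbedding.conjugate σ y)) ≠ 0) := by
  refine ⟨exists_finrank_ne_one_of_range_eq_endAlgRat Φ f hf hη hG hfE hK, ?_⟩
  by_contra h
  simp only [ne_eq, not_exists, not_and_or, not_not] at h
  have h2 := (hX.finrank_eq_card_and_range_eq_of_forall_finrank_eq_zero Φ f hf h).1
  rw [hK, card_eq_two_mul_finrank Φ] at h2
  have hpos : 0 < Fintype.card ι := Fintype.card_pos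
  rw [card_eq_two_mul_finrank Φ] at hpos
  omega

end Corollaries

/-! ## §5. Exceptional case (5): a quaternion algebra over the CM field `K` with `m = 1` reduces to case (4)

Hulek–Laface's fifth exceptional case is «`F` of type IV, `m := g/d²e₀ = 1`, `d = 2` and `r_ν = s_ν = 1` for all
`ν`»: `F = End_ℚ(X)` is a quaternion algebra (`d = 2`) over its centre, the CM field `K` (`e₀ = [K⁺ : ℚ]`), with
`[F : ℚ] = 2 dim X` (`m = 1`), and the tangent multiplicities of `K` are `n_σ = d r_ν = 2` for every `σ`. For a
SIMPLE `X` it does not occur («as in (1) and (2)»). We prove the non-occurrence by REDUCTION TO CASE (4) (route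
deviation from the printed moduli argument, recorded here): a Rosati-symmetric `x ∈ F ∖ K` may be normalised to
`x² = δ ∈ K` (`exists_rosati_eq_self_and_mul_self_eq`); `u := xy − yx ≠ 0` anti-commutes with `x`, so inside each
`2`-dimensional `T_σ` the two eigenlines of `x` (eigenvalues `±√σ(δ)`) are swapped by the invertible `ρ(u)` and are
LINES (`CaseFive.finrank_inf_eigenspace_eq_one`, `finrank_inf_eigenspace_eq_one_of_mul_self_eq`); hence the CM field
`L = K(x) ≅ K[X]/(X² − δ)` — Rosati-stable, of degree `2[K : ℚ] = dim X` — acts with all multiplicities `1`, and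
case (4) (`exists_antilinear_mem_endAlgRat_of_forall_finrank_eq_one`) produces an `L`-ANTILINEAR `0 ≠ W ∈ End_ℚ(X)`:
`W a = ā W` for `a ∈ K`, impossible since `K` is central in `End_ℚ(X)`
(`IsSimple.exists_finrank_ne_two_of_quadratic_over_center`). -/

section CaseFive

namespace CaseFive

variable {𝕜 : Type*} [Field 𝕜] [CharZero 𝕜] {W : Type*} [AddCommGroup W] [Module 𝕜 W]
  [FiniteDimensional 𝕜 W]

/-- **Eigenlines of an anti-commuting pair.** Let `P` be a plane stable under `A` and `B`, with `A² = c ≠ 0` on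
`P`, `B` injective and `AB = −BA` on `P`. Then for `μ² = c` the `μ`-eigenspace of `A` in `P` is a line: `B` swaps
the `μ`- and `(−μ)`-eigenspaces of `A` inside `P` injectively, they are independent, and they span `P`
(`v = (2μ)⁻¹(μv + Av) + (2μ)⁻¹(μv − Av)`). [folklore] -/
private theorem finrank_inf_eigenspace_eq_one {P : Submodule 𝕜 W} {A B : W →ₗ[𝕜] W} {c μ : 𝕜}
    (hP : finrank 𝕜 P = 2) (hAP : ∀ v ∈ P, A v ∈ P) (hBP : ∀ v ∈ P, B v ∈ P)
    (hB : Function.Injective B) (hAA : ∀ v ∈ P, A (A v) = c • v)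
    (hAB : ∀ v ∈ P, A (B v) = -(B (A v))) (hμ : μ * μ = c) (hc : c ≠ 0) :
    finrank 𝕜 ↥(P ⊓ Module.End.eigenspace A μ) = 1 := by
  have hμ0 : μ ≠ 0 := by
    rintro rfl
    exact hc (by rw [← hμ, mul_zero])
  have h2μ : μ + μ ≠ 0 := fun h => hμ0 (add_self_eq_zero.mp h)
  have hmem : ∀ (ν : 𝕜) (v : W), v ∈ P ⊓ Module.End.eigenspace A ν ↔ v ∈ P ∧ A v = ν • v :=
    fun ν v => by rw [Submodule.mem_inf, Module.End.mem_eigenspace_iff]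
  -- `B` maps the `ν`-piece into the `(−ν)`-piece, injectively
  have hmap : ∀ ν : 𝕜, (P ⊓ Module.End.eigenspace A ν).map B ≤ P ⊓ Module.End.eigenspace A (-ν) := by
    intro ν
    rintro _ ⟨v, hv, rfl⟩
    rw [SetLike.mem_coe, hmem] at hv
    rw [hmem]
    exact ⟨hBP v hv.1, by rw [hAB v hv.1, hv.2, map_smul, neg_smul]⟩
  have hle : ∀ ν : 𝕜, finrank 𝕜 ↥(P ⊓ Module.End.eigenspace A ν) ≤
      finrank 𝕜 ↥(P ⊓ Module.End.eigenspace A (-ν)) := fun ν =>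
    calc finrank 𝕜 ↥(P ⊓ Module.End.eigenspace A ν)
        = finrank 𝕜 ↥((P ⊓ Module.End.eigenspace A ν).map B) :=
          LinearEquiv.finrank_eq (Submodule.equivMapOfInjective B hB _)
      _ ≤ _ := Submodule.finrank_mono (hmap ν)
  have hplus := hle μ
  have hminus := hle (-μ)
  rw [neg_neg] at hminus
  -- the two pieces are independent
  have hinf : P ⊓ Module.End.eigenspace A μ ⊓ (P ⊓ Module.End.eigenspace A (-μ)) = ⊥ := by
    rw [eq_bot_iff]
    intro v hv
    rw [Submodule.mem_inf, hmem, hmem] at hv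
    obtain ⟨⟨-, h1⟩, -, h2⟩ := hv
    rw [Submodule.mem_bot]
    have h12 : (μ + μ) • v = 0 := by
      rw [add_smul]
      nth_rw 2 [← h1]
      rw [h2, neg_smul, add_neg_cancel]
    exact (smul_eq_zero.mp h12).resolve_left h2μ
  -- and they span `P`
  have hsup_le : P ⊓ Module.End.eigenspace A μ ⊔ P ⊓ Module.End.eigenspace A (-μ) ≤ P :=
    sup_le inf_le_left inf_le_left
  have hle_sup : P ≤ P ⊓ Module.End.eigenspace A μ ⊔ P ⊓ Module.End.eigenspace A (-μ) := by
    intro v hv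
    have hAv := hAP v hv
    have hvp : (μ + μ)⁻¹ • (μ • v + A v) ∈ P ⊓ Module.End.eigenspace A μ := by
      rw [hmem]
      refine ⟨P.smul_mem _ (P.add_mem (P.smul_mem _ hv) hAv), ?_⟩
      simp only [map_smul, map_add, hAA v hv, ← hμ]
      module
    have hvm : (μ + μ)⁻¹ • (μ • v - A v) ∈ P ⊓ Module.End.eigenspace A (-μ) := by
      rw [hmem]
      refine ⟨P.smul_mem _ (P.sub_mem (P.smul_mem _ hv) hAv), ?_⟩
      simp only [map_smul, map_sub, hAA v hv, ← hμ]
      module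
    have hvv : v = (μ + μ)⁻¹ • (μ • v + A v) + (μ + μ)⁻¹ • (μ • v - A v) := by
      rw [← smul_add, show μ • v + A v + (μ • v - A v) = (μ + μ) • v by rw [add_smul]; abel,
        smul_smul, inv_mul_cancel₀ h2μ, one_smul]
    rw [hvv]
    exact Submodule.add_mem_sup hvp hvm
  have hdim := Submodule.finrank_sup_add_finrank_inf_eq (P ⊓ Module.End.eigenspace A μ)
    (P ⊓ Module.End.eigenspace A (-μ))
  rw [hinf, finrank_bot, add_zero] at hdim
  have h1 := Submodule.finrank_mono hsup_le
  have h2 := Submodule.finrank_mono hle_sup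
  rw [hP] at h1 h2
  omega

end CaseFive

open CaseFive

variable {ι : Type} [Fintype ι] [DecidableEq ι] [Nonempty ι] {E : Type} [NormedAddCommGroup E]
  [NormedSpace ℂ E] [FiniteDimensional ℂ E] (Φ : (ι → ℝ) ≃L[ℝ] E) {K : Type} [Field K] [NumberField K]
  (f : K →ₐ[ℚ] Matrix ι ι ℚ) (hf : ∀ x, f x ∈ endAlgRat Φ) {η : E [⋀^Fin 2]→L[ℝ] ℝ} {G : Matrix ι ι ℚ}

omit [Nonempty ι] [FiniteDimensional ℂ E] in
/-- An endomorphism commuting with `f(K)` preserves every eigenspace `T_σ` of `K` on `T₀X`. [folklore] -/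
private theorem analyticRepHom_apply_mem_iInf_eigenspace {M : Matrix ι ι ℚ} (hM : M ∈ endAlgRat Φ)
    (hcomm : ∀ a, M * f a = f a * M) (σ : K →+* ℂ) {v : E}
    (hv : v ∈ ⨅ y : K, Module.End.eigenspace ((analyticRepHom Φ ⟨f y, hf y⟩ : E →L[ℂ] E) : E →ₗ[ℂ] E) (σ y)) :
    (analyticRepHom Φ ⟨M, hM⟩ : E →L[ℂ] E) v ∈
      ⨅ y : K, Module.End.eigenspace ((analyticRepHom Φ ⟨f y, hf y⟩ : E →L[ℂ] E) : E →ₗ[ℂ] E) (σ y) := by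
  rw [Submodule.mem_iInf] at hv ⊢
  intro y
  have hy := hv y
  rw [Module.End.mem_eigenspace_iff, ContinuousLinearMap.coe_coe] at hy ⊢
  have hmul : (⟨f y, hf y⟩ : endAlgRat Φ) * ⟨M, hM⟩ = ⟨M, hM⟩ * ⟨f y, hf y⟩ :=
    Subtype.ext (hcomm y).symm
  have h := congrArg (fun A : endAlgRat Φ => (analyticRepHom Φ A : E →L[ℂ] E) v) hmul
  simp only [map_mul, mul_apply_eq_comp] at h
  rw [h, hy, map_smul]

omit [FiniteDimensional ℂ E] in
include hf in
/-- **A Rosati-symmetric endomorphism outside the central field.** If `f(K)` is central in `End_ℚ(X)` (so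
`(f a)' = f(ā)`, `ComplexTorusRosatiCM`) and `End_ℚ(X) ≠ f(K)`, some `x = x' ∈ End_ℚ(X)` is not in `f(K)`: for
`z ∉ f(K)` both `z + z'` and `θ(z − z')` (`θ̄ = −θ ≠ 0` in `K`) are symmetric, and not both lie in `f(K)`.
[cite: HulekLaface2019PicardNumbersAV, §5.1 Prop. 5.1 exceptional case (5) (proof)] [folklore] -/
theorem exists_rosati_eq_self_and_not_mem_range [IsCMField K] (hη : IsRiemannForm Φ η)
    (hG : G.map (Rat.cast : ℚ → ℝ) = latticeGram Φ η) (hst : ∀ x, ∃ y, rosati G (f x) = f y)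
    (hcent : ∀ M ∈ endAlgRat Φ, ∀ a, M * f a = f a * M) (hne : ∃ M ∈ endAlgRat Φ, M ∉ Set.range f) :
    ∃ x ∈ endAlgRat Φ, rosati G x = x ∧ x ∉ Set.range f := by
  obtain ⟨a₀, ha₀⟩ : ∃ a, IsCMField.complexConj K a ≠ a := by
    by_contra h
    simp only [ne_eq, not_exists, not_not] at h
    exact IsCMField.complexConj_ne_one K (AlgEquiv.ext h)
  set θ := a₀ - IsCMField.complexConj K a₀ with hθdef
  have hθ : IsCMField.complexConj K θ = -θ := by
    rw [hθdef, map_sub, IsCMField.complexConj_apply_apply, neg_sub]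
  have hθ0 : θ ≠ 0 := fun h => ha₀ (sub_eq_zero.mp h).symm
  have hGu' : IsUnit G.det := isUnit_det_of_map_ratCast hG hη.isUnit_det_latticeGram
  have hGt : Gᵀ = -G := transpose_eq_neg_of_map_ratCast Φ hG
  have hros : ∀ a, rosati G (f a) = f (IsCMField.complexConj K a) := fun a =>
    rosati_algHom_eq_complexConj Φ hη.1 hη.2.2 hG f hf hst a
  obtain ⟨z, hz, hzr⟩ := hne
  have hz' : rosati G z ∈ endAlgRat Φ := rosati_mem_endAlgRat Φ hη.1 hη.2.2 hG hz
  have hs₁ : rosati G (z + rosati G z) = z + rosati G z := by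
    rw [rosati_add, rosati_rosati hGu' hGt, add_comm]
  have hs₂ : rosati G (f θ * (z - rosati G z)) = f θ * (z - rosati G z) := by
    rw [rosati_mul hGu', rosati_sub, rosati_rosati hGu' hGt, hros, hθ, map_neg, mul_neg, ← neg_mul,
      neg_sub, hcent _ (sub_mem hz hz') θ]
  by_cases h₁ : z + rosati G z ∈ Set.range f
  · by_cases h₂ : f θ * (z - rosati G z) ∈ Set.range f
    · exfalso
      obtain ⟨a₁, ha₁⟩ := h₁
      obtain ⟨a₂, ha₂⟩ := h₂
      apply hzr
      refine ⟨2⁻¹ * (a₁ + θ⁻¹ * a₂), ?_⟩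
      have hsum : f a₁ + f θ⁻¹ * f a₂ = f 2 * z := by
        rw [map_ofNat, two_mul, ha₂, ← Matrix.mul_assoc, ← map_mul, inv_mul_cancel₀ hθ0, map_one,
          Matrix.one_mul, ha₁]
        abel
      rw [map_mul, map_add, map_mul, hsum, ← Matrix.mul_assoc, ← map_mul, inv_mul_cancel₀ two_ne_zero,
        map_one, Matrix.one_mul]
    · exact ⟨_, mul_mem (hf θ) (sub_mem hz hz'), hs₂, h₂⟩
  · exact ⟨_, add_mem hz hz', hs₁, h₁⟩

omit [FiniteDimensional ℂ E] in
include hf in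
/-- **Normalisation: a symmetric `x ∉ f(K)` with `x² = f(δ)`, `δ ∈ K`.** If moreover every endomorphism is
quadratic over `f(K)` (`M² = f(a)M + f(b)` — `End_ℚ(X)` has degree `≤ 2` over its central subfield `K`), the
symmetric `x` of `exists_rosati_eq_self_and_not_mem_range` has `x² = f(a)x + f(b)` with `ā = a` (apply `'`), and
`x − f(a/2)` is symmetric, outside `f(K)`, with square `f(b + a²/4)`.
[cite: HulekLaface2019PicardNumbersAV, §5.1 Prop. 5.1 exceptional case (5) (proof)] [folklore] -/
theorem exists_rosati_eq_self_and_mul_self_eq [IsCMField K] (hη : IsRiemannForm Φ η)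
    (hG : G.map (Rat.cast : ℚ → ℝ) = latticeGram Φ η) (hst : ∀ x, ∃ y, rosati G (f x) = f y)
    (hcent : ∀ M ∈ endAlgRat Φ, ∀ a, M * f a = f a * M)
    (hquad : ∀ M ∈ endAlgRat Φ, ∃ a b : K, M * M = f a * M + f b)
    (hne : ∃ M ∈ endAlgRat Φ, M ∉ Set.range f) :
    ∃ x ∈ endAlgRat Φ, ∃ δ : K, rosati G x = x ∧ x ∉ Set.range f ∧ x * x = f δ := by
  obtain ⟨x, hx, hxr, hxf⟩ := exists_rosati_eq_self_and_not_mem_range Φ f hf hη hG hst hcent hne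
  obtain ⟨a, b, hab⟩ := hquad x hx
  have hGu' : IsUnit G.det := isUnit_det_of_map_ratCast hG hη.isUnit_det_latticeGram
  have hros : ∀ a, rosati G (f a) = f (IsCMField.complexConj K a) := fun a =>
    rosati_algHom_eq_complexConj Φ hη.1 hη.2.2 hG f hf hst a
  have hc : ∀ a, x * f a = f a * x := hcent x hx
  -- `a` is real, otherwise `x ∈ f(K)`
  have ha : IsCMField.complexConj K a = a := by
    by_contra ha
    apply hxf
    have h := congrArg (rosati G) hab
    rw [rosati_mul hGu', hxr, rosati_add, rosati_mul hGu', hxr, hros, hros, hc, hab] at h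
    -- `h : f a * x + f b = f ā * x + f b̄`
    have h' : (f a - f (IsCMField.complexConj K a)) * x = f (IsCMField.complexConj K b) - f b := by
      rw [sub_mul]
      exact sub_eq_sub_iff_add_eq_add.mpr (h.trans (add_comm _ _))
    rw [← map_sub, ← map_sub] at h'
    have hne0 : a - IsCMField.complexConj K a ≠ 0 := sub_ne_zero.mpr (fun e => ha e.symm)
    refine ⟨(a - IsCMField.complexConj K a)⁻¹ * (IsCMField.complexConj K b - b), ?_⟩
    rw [map_mul, ← h', ← Matrix.mul_assoc, ← map_mul, inv_mul_cancel₀ hne0, map_one, Matrix.one_mul]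
  refine ⟨x - f (a / 2), sub_mem hx (hf _), b + a / 2 * (a / 2), ?_, ?_, ?_⟩
  · rw [rosati_sub, hxr, hros, map_div₀, ha, map_ofNat]
  · rintro ⟨r, hr⟩
    exact hxf ⟨r + a / 2, by rw [map_add, hr, sub_add_cancel]⟩
  · have key : (x - f (a / 2)) * (x - f (a / 2)) =
        x * x - f (a / 2) * x - f (a / 2) * x + f (a / 2) * f (a / 2) := by
      rw [sub_mul, mul_sub, mul_sub, hc]
      abel
    rw [key, hab, ← map_mul, show f a * x + f b - f (a / 2) * x - f (a / 2) * x + f (a / 2 * (a / 2))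
        = (f a - f (a / 2) - f (a / 2)) * x + (f b + f (a / 2 * (a / 2))) by noncomm_ring,
      ← map_sub, ← map_sub, show a - a / 2 - a / 2 = 0 by ring, map_zero, Matrix.zero_mul, zero_add,
      ← map_add]

/-- **Multiplicity splitting (the heart of the reduction).** For `X` simple with `f(K)` central in `End_ℚ(X)`, an
endomorphism `x` with `x² = f(δ)` not commuting with some `y ∈ End_ℚ(X)`, and an embedding `σ` with
`dim T_σ = 2`: each eigenvalue `μ = ±√σ(δ)` of `ρ(x)` on `T_σ` has an eigenLINE. Indeed `δ ≠ 0`, `u := xy − yx ≠ 0`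
is invertible (`X` simple) with `ux = −xu`, and `CaseFive.finrank_inf_eigenspace_eq_one` applies to `ρ(x)`, `ρ(u)`
on `T_σ`. [cite: HulekLaface2019PicardNumbersAV, §5.1 Prop. 5.1 exceptional case (5) (proof)] [folklore] -/
theorem finrank_inf_eigenspace_eq_one_of_mul_self_eq (hX : IsSimple Φ)
    (hcent : ∀ M ∈ endAlgRat Φ, ∀ a, M * f a = f a * M) {x : Matrix ι ι ℚ} (hx : x ∈ endAlgRat Φ) {δ : K}
    (hxx : x * x = f δ) (hy : ∃ y ∈ endAlgRat Φ, x * y ≠ y * x) (σ : K →+* ℂ)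
    (h2 : finrank ℂ ↥(⨅ y : K,
      Module.End.eigenspace ((analyticRepHom Φ ⟨f y, hf y⟩ : E →L[ℂ] E) : E →ₗ[ℂ] E) (σ y)) = 2)
    {μ : ℂ} (hμ : μ * μ = σ δ) :
    finrank ℂ ↥((⨅ y : K,
      Module.End.eigenspace ((analyticRepHom Φ ⟨f y, hf y⟩ : E →L[ℂ] E) : E →ₗ[ℂ] E) (σ y)) ⊓
      Module.End.eigenspace ((analyticRepHom Φ ⟨x, hx⟩ : E →L[ℂ] E) : E →ₗ[ℂ] E) μ) = 1 := by
  obtain ⟨y, hy, hxy⟩ := hy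
  have hx0 : x ≠ 0 := by
    rintro rfl
    exact hxy (by rw [Matrix.zero_mul, Matrix.mul_zero])
  have hδ : δ ≠ 0 := by
    rintro rfl
    rw [map_zero] at hxx
    have hu := (hX.isUnit_of_mem_endAlgRat hx hx0).mul (hX.isUnit_of_mem_endAlgRat hx hx0)
    rw [hxx] at hu
    exact not_isUnit_zero hu
  set u := x * y - y * x with hu_def
  have hu : u ∈ endAlgRat Φ := sub_mem (mul_mem hx hy) (mul_mem hy hx)
  have hu0 : u ≠ 0 := sub_ne_zero.mpr hxy
  have hux : x * u = -(u * x) := by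
    rw [eq_neg_iff_add_eq_zero, hu_def,
      show x * (x * y - y * x) + (x * y - y * x) * x = x * x * y - y * (x * x) by noncomm_ring,
      hxx, hcent y hy δ, sub_self]
  have hui : u⁻¹ ∈ endAlgRat Φ := inv_mem_endAlgRat Φ hu
  have huinv : u⁻¹ * u = 1 := hX.inv_mul_of_mem_endAlgRat hu hu0
  have hB : Function.Injective ((analyticRepHom Φ ⟨u, hu⟩ : E →L[ℂ] E) : E →ₗ[ℂ] E) := by
    have h1 : (⟨u⁻¹, hui⟩ : endAlgRat Φ) * ⟨u, hu⟩ = 1 := Subtype.ext huinv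
    have hli : Function.LeftInverse (analyticRepHom Φ ⟨u⁻¹, hui⟩ : E →L[ℂ] E)
        (analyticRepHom Φ ⟨u, hu⟩ : E →L[ℂ] E) := fun v => by
      rw [← mul_apply_eq_comp, ← map_mul, h1, map_one, one_apply_eq_self]
    exact hli.injective
  refine CaseFive.finrank_inf_eigenspace_eq_one h2
    (fun v hv => analyticRepHom_apply_mem_iInf_eigenspace Φ f hf hx (hcent x hx) σ hv)
    (fun v hv => analyticRepHom_apply_mem_iInf_eigenspace Φ f hf hu (hcent u hu) σ hv) hB
    (fun v hv => ?_) (fun v _ => ?_) hμ ((map_ne_zero σ).mpr hδ)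
  · have hv' := (Submodule.mem_iInf _).mp hv δ
    rw [Module.End.mem_eigenspace_iff, ContinuousLinearMap.coe_coe] at hv'
    have h1 : (⟨x, hx⟩ : endAlgRat Φ) * ⟨x, hx⟩ = ⟨f δ, hf δ⟩ := Subtype.ext hxx
    show (analyticRepHom Φ ⟨x, hx⟩ : E →L[ℂ] E) ((analyticRepHom Φ ⟨x, hx⟩ : E →L[ℂ] E) v) = σ δ • v
    rw [← mul_apply_eq_comp, ← map_mul, h1, hv']
  · have h1 : (⟨x, hx⟩ : endAlgRat Φ) * ⟨u, hu⟩ = -(⟨u, hu⟩ * ⟨x, hx⟩) := Subtype.ext hux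
    show (analyticRepHom Φ ⟨x, hx⟩ : E →L[ℂ] E) ((analyticRepHom Φ ⟨u, hu⟩ : E →L[ℂ] E) v) =
      -((analyticRepHom Φ ⟨u, hu⟩ : E →L[ℂ] E) ((analyticRepHom Φ ⟨x, hx⟩ : E →L[ℂ] E) v))
    rw [← mul_apply_eq_comp, ← map_mul, h1, map_neg, map_mul, _root_.neg_apply, mul_apply_eq_comp]

include hf in
/-- **HULEK–LAFACE PROP. 5.1, EXCEPTIONAL CASE (5), IN EVERY DIMENSION (non-occurrence for simple `X`).** Let `X`
be a simple polarised complex torus and `K` a CM field with `f : K → End_ℚ(X)` onto the CENTRE of `End_ℚ(X)`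
(`hcenter`), such that `End_ℚ(X) ≠ f(K)` and every endomorphism is quadratic over `f(K)` — i.e. `End_ℚ(X)` is a
quaternion (division) algebra over its centre `K`, Albert type IV with `d = 2` — and `2[K : ℚ] = dim X` (`m = 1`).
Then the tangent multiplicities of `K` are NOT all equal to `2`: the signature «`r_ν = s_ν = 1` for all `ν`» does
not occur. Proof by reduction to case (4), see the section docstring: the CM field `L = K(x) ≅ K[X]/(X² − δ)`
(`AdjoinRoot`), `x = x'`, `x² = f(δ)`, has `[L : ℚ] = dim X`, is Rosati-stable with all multiplicities `1`
(`finrank_inf_eigenspace_eq_one_of_mul_self_eq`), so `exists_antilinear_mem_endAlgRat_of_forall_finrank_eq_one`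
gives `0 ≠ W ∈ End_ℚ(X)` with `W f(a) = f(ā) W`, contradicting the centrality of `f(K)`.
[cite: HulekLaface2019PicardNumbersAV, §5.1 Prop. 5.1 exceptional case (5) ("type IV, `m = 1`, `d = 2`, `r_ν = s_ν = 1`") and proof ("as in (1) and (2)": never occurs for simple `X`)]
[cite: Shimura1963AnalyticFamilies, §4 Thm. 5 (via Hulek–Laface)] -/
theorem IsSimple.exists_finrank_ne_two_of_quadratic_over_center [IsCMField K] (hX : IsSimple Φ)
    (hη : IsRiemannForm Φ η) (hG : G.map (Rat.cast : ℚ → ℝ) = latticeGram Φ η)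
    (hcenter : ∀ M ∈ endAlgRat Φ, (∀ N ∈ endAlgRat Φ, M * N = N * M) ↔ M ∈ Set.range f)
    (hquad : ∀ M ∈ endAlgRat Φ, ∃ a b : K, M * M = f a * M + f b)
    (hne : ∃ M ∈ endAlgRat Φ, M ∉ Set.range f) (hK : 2 * finrank ℚ K = finrank ℂ E) :
    ∃ σ : K →+* ℂ, finrank ℂ ↥(⨅ y : K,
      Module.End.eigenspace ((analyticRepHom Φ ⟨f y, hf y⟩ : E →L[ℂ] E) : E →ₗ[ℂ] E) (σ y)) ≠ 2 := by
  by_contra h2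
  simp only [ne_eq, not_exists, not_not] at h2
  have hGu' : IsUnit G.det := isUnit_det_of_map_ratCast hG hη.isUnit_det_latticeGram
  have hGt : Gᵀ = -G := transpose_eq_neg_of_map_ratCast Φ hG
  -- `f(K)` is central, hence Rosati-stable
  have hcent : ∀ M ∈ endAlgRat Φ, ∀ a, M * f a = f a * M := fun M hM a =>
    ((hcenter (f a) (hf a)).mpr ⟨a, rfl⟩ M hM).symm
  have hst : ∀ a, ∃ b, rosati G (f a) = f b := fun a => by
    have hra : rosati G (f a) ∈ endAlgRat Φ := rosati_mem_endAlgRat Φ hη.1 hη.2.2 hG (hf a)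
    obtain ⟨b, hb⟩ := (hcenter _ hra).mp fun N hN => by
      have hN' : rosati G N ∈ endAlgRat Φ := rosati_mem_endAlgRat Φ hη.1 hη.2.2 hG hN
      conv_lhs => rw [← rosati_rosati hGu' hGt N]
      rw [← rosati_mul hGu', hcent _ hN' a, rosati_mul hGu', rosati_rosati hGu' hGt]
    exact ⟨b, hb.symm⟩
  have hros : ∀ a, rosati G (f a) = f (IsCMField.complexConj K a) := fun a =>
    rosati_algHom_eq_complexConj Φ hη.1 hη.2.2 hG f hf hst a
  -- the symmetric square root `x`, `x² = f(δ)`, and a non-commuting partner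
  obtain ⟨x, hx, δ, hxr, hxf, hxx⟩ :=
    exists_rosati_eq_self_and_mul_self_eq Φ f hf hη hG hst hcent hquad hne
  have hy : ∃ y ∈ endAlgRat Φ, x * y ≠ y * x := by
    by_contra h
    simp only [ne_eq, not_exists, not_and, not_not] at h
    exact hxf ((hcenter x hx).mp h)
  have hcx : ∀ a, x * f a = f a * x := hcent x hx
  -- `X² − δ` is irreducible over `K` (`δ` is not a square: `X` is simple)
  set p : Polynomial K := Polynomial.X ^ 2 - Polynomial.C δ with hp_def
  have hpm : p.Monic := Polynomial.monic_X_pow_sub_C δ two_ne_zero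
  have hpd : p.natDegree = 2 := Polynomial.natDegree_X_pow_sub_C
  have hp0 : p ≠ 0 := hpm.ne_zero
  have hirr : Irreducible p := by
    rw [hpm.irreducible_iff_roots_eq_zero_of_degree_le_three (by omega) (by omega),
      Multiset.eq_zero_iff_forall_notMem]
    intro r hr
    rw [Polynomial.mem_roots hp0, Polynomial.IsRoot.def, hp_def, Polynomial.eval_sub, Polynomial.eval_pow,
      Polynomial.eval_X, Polynomial.eval_C, sub_eq_zero] at hr
    have hfac : (x - f r) * (x + f r) = 0 := by
      rw [sub_mul, mul_add, mul_add, hcx r, hxx, ← map_mul, ← hr, pow_two]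
      abel
    rcases eq_or_ne (x - f r) 0 with h0 | h0
    · exact hxf ⟨r, (sub_eq_zero.mp h0).symm⟩
    · have hx' : x + f r = 0 := (hX.isUnit_of_mem_endAlgRat (sub_mem hx (hf r)) h0).mul_right_eq_zero.mp hfac
      exact hxf ⟨-r, by rw [map_neg]; exact (eq_neg_of_add_eq_zero_left hx').symm⟩
  haveI : Fact (Irreducible p) := ⟨hirr⟩
  -- `L = K[X]/(p)` as a number field (with the `ℚ`-algebra structure of a characteristic-zero division ring)
  haveI hcz : CharZero (AdjoinRoot p) :=
    charZero_of_injective_algebraMap (algebraMap K (AdjoinRoot p)).injective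
  letI : Algebra ℚ (AdjoinRoot p) := DivisionRing.toRatAlgebra
  haveI : IsScalarTower ℚ K (AdjoinRoot p) :=
    IsScalarTower.of_algebraMap_eq fun q => (map_ratCast (algebraMap K (AdjoinRoot p)) q).symm
  haveI : Module.Finite K (AdjoinRoot p) := (AdjoinRoot.powerBasis hp0).finite
  haveI : FiniteDimensional ℚ (AdjoinRoot p) := Module.Finite.trans K (AdjoinRoot p)
  haveI : NumberField (AdjoinRoot p) := NumberField.mk
  -- the embedding `fL : L → End_ℚ(X)`, `a + b·X ↦ f(a) + f(b)x`
  set e : Polynomial K →+* Matrix ι ι ℚ :=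
    Polynomial.eval₂RingHom' (f : K →+* Matrix ι ι ℚ) x (fun a => (hcx a).symm) with he_def
  have he : ∀ q, e q = q.eval₂ (f : K →+* Matrix ι ι ℚ) x := fun q => rfl
  have hep : e p = 0 := by
    rw [he, hp_def, Polynomial.eval₂_sub, Polynomial.eval₂_X_pow, Polynomial.eval₂_C, pow_two, hxx]
    exact sub_self _
  have hker : ∀ q ∈ Ideal.span {p}, e q = 0 := fun q hq => by
    obtain ⟨r, rfl⟩ := Ideal.mem_span_singleton'.mp hq
    rw [map_mul, hep, mul_zero]
  obtain ⟨fL, hfL⟩ : ∃ fL : AdjoinRoot p →ₐ[ℚ] Matrix ι ι ℚ,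
      ∀ q, fL (AdjoinRoot.mk p q) = q.eval₂ (f : K →+* Matrix ι ι ℚ) x :=
    ⟨(Ideal.Quotient.lift (Ideal.span {p}) e hker).toRatAlgHom, fun q => Ideal.Quotient.lift_mk _ _ _⟩
  have hfLof : ∀ a, fL (AdjoinRoot.of p a) = f a := fun a => by
    rw [show AdjoinRoot.of p a = AdjoinRoot.mk p (Polynomial.C a) from rfl, hfL, Polynomial.eval₂_C,
      RingHom.coe_coe]
  have hfLroot : fL (AdjoinRoot.root p) = x := by
    rw [← AdjoinRoot.mk_X, hfL, Polynomial.eval₂_X]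
  have hfLE : ∀ ℓ, fL ℓ ∈ endAlgRat Φ := fun ℓ => by
    obtain ⟨q, rfl⟩ := AdjoinRoot.mk_surjective ℓ
    rw [hfL]
    refine Polynomial.induction_on' q (fun q₁ q₂ h₁ h₂ => ?_) (fun n a => ?_)
    · rw [Polynomial.eval₂_add]
      exact add_mem h₁ h₂
    · rw [Polynomial.eval₂_monomial, RingHom.coe_coe]
      exact mul_mem (hf a) (pow_mem hx n)
  -- `fL(L)` is Rosati-stable: `'` conjugates the coefficients
  have hxpow : ∀ n : ℕ, rosati G (x ^ n) = x ^ n := fun n => by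
    induction n with
    | zero => rw [pow_zero, rosati_one hGu']
    | succ n ih => rw [pow_succ', rosati_mul hGu', ih, hxr, ← pow_succ, ← pow_succ']
  have hstL : ∀ ℓ, ∃ ℓ', rosati G (fL ℓ) = fL ℓ' := fun ℓ => by
    obtain ⟨q, rfl⟩ := AdjoinRoot.mk_surjective ℓ
    refine ⟨AdjoinRoot.mk p (q.map (IsCMField.complexConj K : K →+* K)), ?_⟩
    rw [hfL, hfL]
    refine Polynomial.induction_on' q (fun q₁ q₂ h₁ h₂ => ?_) (fun n a => ?_)
    · rw [Polynomial.eval₂_add, rosati_add, h₁, h₂, Polynomial.map_add, Polynomial.eval₂_add]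
    · rw [Polynomial.map_monomial, Polynomial.eval₂_monomial, Polynomial.eval₂_monomial, rosati_mul hGu',
        hxpow, RingHom.coe_coe, RingHom.coe_coe, hros, hcent _ (pow_mem hx n)]
  have hneL : ∃ ℓ, rosati G (fL ℓ) ≠ fL ℓ := by
    obtain ⟨a, ha⟩ : ∃ a, IsCMField.complexConj K a ≠ a := by
      by_contra h
      simp only [ne_eq, not_exists, not_not] at h
      exact IsCMField.complexConj_ne_one K (AlgEquiv.ext h)
    exact ⟨AdjoinRoot.of p a, by rw [hfLof, hros]; exact fun h => ha (f.toRingHom.injective h)⟩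
  haveI : IsCMField (AdjoinRoot p) := isCMField_of_rosati_ne Φ hη.1 hη.2.2 hG fL hfLE hstL hneL
  -- `[L : ℚ] = 2 [K : ℚ] = dim X`
  have hKL : finrank ℚ (AdjoinRoot p) = finrank ℂ E := by
    rw [← Module.finrank_mul_finrank ℚ K (AdjoinRoot p), (AdjoinRoot.powerBasis hp0).finrank,
      AdjoinRoot.powerBasis_dim hp0, hpd, mul_comm, hK]
  -- all multiplicities of `L` are `1`
  let gL : AdjoinRoot p →+* (E →L[ℂ] E) :=
    (analyticRepHom Φ).comp ((fL : AdjoinRoot p →+* Matrix ι ι ℚ).codRestrict (endAlgRat Φ) hfLE)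
  have hgL : ∀ ℓ, gL ℓ = analyticRepHom Φ ⟨fL ℓ, hfLE ℓ⟩ := fun ℓ => rfl
  have eK : ∀ a, (analyticRepHom Φ ⟨f a, hf a⟩ : E →L[ℂ] E) = gL (AdjoinRoot.of p a) := fun a => by
    rw [hgL]; congr 1; exact Subtype.ext (hfLof a).symm
  have ex : (analyticRepHom Φ ⟨x, hx⟩ : E →L[ℂ] E) = gL (AdjoinRoot.root p) := by
    rw [hgL]; congr 1; exact Subtype.ext hfLroot.symm
  have h1L : ∀ τ : AdjoinRoot p →+* ℂ, finrank ℂ ↥(⨅ ℓ : AdjoinRoot p,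
      Module.End.eigenspace ((analyticRepHom Φ ⟨fL ℓ, hfLE ℓ⟩ : E →L[ℂ] E) : E →ₗ[ℂ] E) (τ ℓ)) = 1 := by
    intro τ
    set σ : K →+* ℂ := τ.comp (AdjoinRoot.of p) with hσ
    have hμ : τ (AdjoinRoot.root p) * τ (AdjoinRoot.root p) = σ δ := by
      have h : AdjoinRoot.root p * AdjoinRoot.root p = AdjoinRoot.of p δ := by
        rw [← sub_eq_zero, ← pow_two, ← AdjoinRoot.mk_X, ← map_pow,
          show AdjoinRoot.of p δ = AdjoinRoot.mk p (Polynomial.C δ) from rfl, ← map_sub]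
        exact AdjoinRoot.mk_self
      rw [← map_mul, h, hσ, RingHom.comp_apply]
    have hST : (⨅ ℓ : AdjoinRoot p,
        Module.End.eigenspace ((analyticRepHom Φ ⟨fL ℓ, hfLE ℓ⟩ : E →L[ℂ] E) : E →ₗ[ℂ] E) (τ ℓ)) =
        (⨅ y : K, Module.End.eigenspace ((analyticRepHom Φ ⟨f y, hf y⟩ : E →L[ℂ] E) : E →ₗ[ℂ] E) (σ y)) ⊓
          Module.End.eigenspace ((analyticRepHom Φ ⟨x, hx⟩ : E →L[ℂ] E) : E →ₗ[ℂ] E)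
            (τ (AdjoinRoot.root p)) := by
      ext v
      simp only [Submodule.mem_inf, Submodule.mem_iInf, Module.End.mem_eigenspace_iff,
        ContinuousLinearMap.coe_coe]
      constructor
      · intro hv
        refine ⟨fun a => ?_, ?_⟩
        · have h := hv (AdjoinRoot.of p a)
          rw [← hgL, ← eK] at h
          exact h
        · have h := hv (AdjoinRoot.root p)
          rw [← hgL, ← ex] at h
          exact h
      · rintro ⟨hvK, hvx⟩ ℓ
        rw [← hgL]
        obtain ⟨q, rfl⟩ := AdjoinRoot.mk_surjective ℓ
        refine Polynomial.induction_on q (fun a => ?_) (fun q₁ q₂ h₁ h₂ => ?_) (fun n a h => ?_)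
        · show gL (AdjoinRoot.of p a) v = τ (AdjoinRoot.of p a) • v
          rw [← eK]
          exact hvK a
        · rw [map_add, map_add, _root_.add_apply, h₁, h₂, map_add, add_smul]
        · rw [pow_succ, ← mul_assoc, map_mul, map_mul gL, map_mul τ, mul_apply_eq_comp, AdjoinRoot.mk_X,
            ← ex, hvx, map_smul, h, smul_smul, mul_comm]
    rw [hST]
    exact finrank_inf_eigenspace_eq_one_of_mul_self_eq Φ f hf hX hcent hx hxx hy σ (h2 σ) hμ
  -- case (4) for `L`: an `L`-antilinear endomorphism
  obtain ⟨W, c₀, hW, -, hc₀0, hWW, hWa, -⟩ :=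
    exists_antilinear_mem_endAlgRat_of_forall_finrank_eq_one Φ fL hfLE hη hG hstL hKL h1L
  -- complex conjugation of `L` restricts to that of `K`
  obtain ⟨a, ha⟩ : ∃ a, IsCMField.complexConj K a ≠ a := by
    by_contra h
    simp only [ne_eq, not_exists, not_not] at h
    exact IsCMField.complexConj_ne_one K (AlgEquiv.ext h)
  have hτ : Nonempty (AdjoinRoot p →+* ℂ) := by
    rw [← Fintype.card_pos_iff, NumberField.Embeddings.card]
    exact Module.finrank_pos
  obtain ⟨τ⟩ := hτ
  have hca : IsCMField.complexConj (AdjoinRoot p) (AdjoinRoot.of p a) =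
      AdjoinRoot.of p (IsCMField.complexConj K a) := by
    apply τ.injective
    have h := IsCMField.complexEmbedding_complexConj K (τ.comp (AdjoinRoot.of p)) a
    rw [RingHom.comp_apply, RingHom.comp_apply] at h
    rw [IsCMField.complexEmbedding_complexConj, h]
  -- contradiction with the centrality of `f(K)`
  have h1 : W * f a = f (IsCMField.complexConj K a) * W := by
    have h := hWa (AdjoinRoot.of p a)
    rwa [hca, hfLof, hfLof] at h
  have h3 : f (IsCMField.complexConj K a - a) * W = 0 := by
    rw [map_sub, sub_mul, ← h1, hcent W hW a, sub_self]
  have hW0 : W = 0 := by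
    have hne0 : IsCMField.complexConj K a - a ≠ 0 := sub_ne_zero.mpr ha
    have h := congrArg (f (IsCMField.complexConj K a - a)⁻¹ * ·) h3
    simpa only [← Matrix.mul_assoc, ← map_mul, inv_mul_cancel₀ hne0, map_one, Matrix.one_mul,
      Matrix.mul_zero] using h
  have hc0 : fL c₀ = 0 := by rw [← hWW, hW0, Matrix.mul_zero]
  exact hc₀0 ((map_eq_zero_iff fL fL.toRingHom.injective).mp hc0)

end CaseFive

end ComplexTorus

end Literature.Geometry.Kaehler
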